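import Literature.MathematicalPhysics.QuantumFieldTheory.Balaban1983to89.B4Cor23Region
import Literature.MathematicalPhysics.QuantumFieldTheory.Balaban1983to89.B4Cor23RegionDeltaAlg

/-!
# [B4] Corollary 2.3, the `δG_k(Ω,Ω₀,A)` clause AT `A ≠ 0`, part II: the estimates

T. Bałaban, *Regularity and decay of lattice Green's functions*, Comm. Math. Phys. **89** (1983) 571–597
(`Balaban1983RegularityDecay`), p. 573 (1.11) and p. 581, end of Corollary 2.3:

«δG_k(Ω,Ω₀,A) = G_k(Ω,A) − G_k(Ω₀,A)»  (1.11, `Ω ⊂ Ω₀`, acting on configurations defined on `Ω`);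

«The same inequalities hold for δG_k(Ω,Ω₀,A) with the additional factor
e^{−δ₀(dist(supp f,Ω^c) + dist(supp f',Ω^c))}».

## What is proved (sorry-free; counting pairings, lattice units, as in the whole `A ≠ 0` chain of this package)

For [B4]'s region operators `H_k(Ω,A) = −Δ^{η,N}_{A,Ω} + m² + a_kP_k(A)` (1.6) on the fine regions
`fineDom n Ωc ⊆ fineDom n Ω₀c` over NESTED finite unions of unit blocks `Ωc ⊆ Ω₀c` (module `B4Lemma21Region`),
under the printed regularity (1.7) of `A` on the larger region and the smallness of `e` (the `Printed` bundle of
`B4Lemma21Region` / `B4Cor23Region`), for EVERY mesh `η = 1/n`, EVERY mass `m² ≥ 0`, all `R^N`-valued `f, f'` on `Ω`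
and all directions `μ, ν`, with `δG = G_k(Ω,A) − G_k(Ω₀,A)|_Ω` (`B4Cor23RegionDeltaAlg.dGv`) and `D = D^η_{A,μ}` on `Ω`:

  `|⟨f, δG f'⟩|, |⟨f, D_μ δG f'⟩|, |⟨f, δG D_ν^* f'⟩|, |⟨f, D_μ δG D_ν^* f'⟩|`
     `≤ c₁(d,a) · exp(−(δ₀(d,a)/2)·(dist_η(supp f, supp f') + dist_η(supp f, Ω₀∖Ω) + dist_η(supp f', Ω₀∖Ω))) ‖f‖₂‖f'‖₂`

(`dcor23_main_region`; printed quantifier shape «there exist positive constants …, e sufficiently small»: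
`dcor23_region_exists`, non-vacuous: `dcor23_region_exists_rot`), with the EXPLICIT constants `c₁(d,a)` (`c1R`) and
`δ₀(d,a)` = `B4Cor23Region.delta0R` of the `G_k(Ω,A)` clause.  HONEST SCOPE: (i) the rate is `δ₀/2` (any rate below `δ₀` would do; the printed statement has one
unspecified `δ₀ > 0` for both clauses, so this is the printed assertion with an explicit, smaller rate); (ii) the
boundary distances are measured to the fine points of `Ω₀ ∖ Ω` inside `Ω₀` (`bdistV`), which is `≥ dist(supp f, Ω^c)`,
so the factor here is at least as strong as the printed one; (iii) when `Ω₀ ∖ Ω` has no fine points the boundary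
distances are `0` by convention and the bound is the `G_k` clause.

## Method (the paper gives no proof of this clause: «the proof proceeds as before»; ours is a cutoff argument)

With the Lipschitz cutoff `θ = 1 − χ` of `B4Cor23ZeroDelta` §8 (`θ = 1` on the boundary layer, `θ = 0` beyond
`dist_η(·, Ω₀∖Ω) > 2`) and `u = G_k(Ω,A)f'`, part I (`B4Cor23RegionDeltaAlg.dot_dGv_eq_cutoff`) gives the identity
`⟨f, δG f'⟩ = ⟨f, θu⟩ − ⟨(G_k(Ω₀,A) ext f)|_Ω, H_k(Ω,A)(θu)⟩`.  The first term is a `G_k(Ω,A)` pairing of the main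
clause with `f` replaced by `θf` (supported within distance `4` of `Ω₀∖Ω`); the second is expanded through
`−Δ^{η,N}_{A,Ω} = Σ_μ D_μ^*D_μ` (`covLap_biform_eq_sum`, (1.3)), the mass and `a_kQ_k^*Q_k` and bounded by Cauchy–Schwarz
by products of COLLAR MASSES `Σ_{dist ≤ 4} |v|², Σ |D_μ v|²` of `v = (G_k(Ω₀,A)Φ)|_Ω` and of `u, D_μu`, which decay by
the set-to-set Combes–Thomas estimates of `B4Cor23Region` §D on `Ω₀` and on `Ω` (with the coercivity constant
`min(2,a)/4 + m²`, which makes the mass term uniform in `m²`); the geometric mean of this bound and the bound of the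
main clause gives the rate `δ₀/2` in all three distances.

## Tags

`[cite: Balaban1983RegularityDecay, …]` marks the LOCATION of the statement being formalised; `[folklore]` marks
elementary algebra / analysis proved here; `[cite: CombesThomas1973, §II]` the Combes–Thomas method.  No result of the
paper under audit is used as a hypothesis.  This is upstream infrastructure for the `η`-uniformity audit of [B4] only
(value = kernel certificate of a published lemma-level statement; no claim about the continuum limit, the
infinite-volume limit, the mass gap, or `Summit.QuantumFields` is made or approached).

v1.1 (DOCFIX, 2026-08-19, self-audit of every «» unit against transcript-B4.md; the XREADs of this module were clean):
glyph-level normalisation inside quotation units only (prime `f'` as printed, `e^{…}` as printed, «Ω and A are as in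
Proposition I.2.1» with its verb); no Lean statement or proof changed.
-/

namespace Literature.MathematicalPhysics.QuantumFieldTheory.Balaban1983to89.B4Cor23RegionDelta

open Matrix Finset
open Literature.MathematicalPhysics.QuantumFieldTheory.Balaban1983to89.B4GaugeCovariance
open Literature.MathematicalPhysics.QuantumFieldTheory.Balaban1983to89.B4Lower18Regular
  (orth_dotProduct_mulVec_self dotProduct_eq_sum_fld transport_fieldLink e1 dotProduct_self_nonneg'
    sum_smul_dotProduct_self_le threshold_exists rot_lipschitz)
open Literature.MathematicalPhysics.QuantumFieldTheory.Balaban1983to89.B4TwoRegion120 (incl incl_val incl_injective)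
open Literature.MathematicalPhysics.QuantumFieldTheory.Balaban1983to89.B4Reflection242 (nbrs nbrs_comm blk mem_nbrs)
open Literature.MathematicalPhysics.QuantumFieldTheory.Balaban1983to89.B4ContourShift (supNorm supNorm_nonneg)
open Literature.MathematicalPhysics.QuantumFieldTheory.Balaban1983to89.B4BoxCov237 (supNorm_sub_le_of_blk_eq)
open Literature.MathematicalPhysics.QuantumFieldTheory.Balaban1983to89.B4Lower18
  (fineDom mem_fineDom edistR supNorm_sub_le_one_of_mem_nbrs)
open Literature.MathematicalPhysics.QuantumFieldTheory.Balaban1983to89.B4Lower18RegularRegion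
  (regWt rBlkWt rbaseEmb rstairContour compField regWt_nonneg rBlkWt_nonneg rBlkWt_ne_zero sum_rBlkWt_row
    sum_rBlkWt_col e1_inj ne_add_e1_add_e1)
open Literature.MathematicalPhysics.QuantumFieldTheory.Balaban1983to89.B4Lemma21Region
  (regionOp regionDeriv covDeriv dirWt mulVec_inv_mulVec fld_covDeriv_mulVec_of_mem fld_covDeriv_mulVec_of_not_mem
    regionOp_form_ge regionDeriv_sq_le_form dotProduct_sq_le fieldLink_rev compField_rev)
open Literature.MathematicalPhysics.QuantumFieldTheory.Balaban1983to89.B4Cor23Zero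
  (ctw abs_ctw_sub_le edistR_nonneg edistR_comm edistR_triangle)
open Literature.MathematicalPhysics.QuantumFieldTheory.Balaban1983to89.B4Cor23ZeroDelta
  (bdR mem_bdR outR mem_outR setDist setDist_le inclEmb dout abs_dout_sub_le dout_le exists_dout_eq cutF cutF_nonneg
    cutF_le_one abs_cutF_sub_le cutF_eq_zero_of_mem_bdR cutF_eq_one_of_lt collar mem_collar mem_collar_of_cutF_ne_one
    mem_collar_of_jump edistR_le_of_mem_nbrs edistR_incl)
open Literature.MathematicalPhysics.QuantumFieldTheory.Balaban1983to89.B4Cor23Region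
  (CTHyp cerr cerr_regionOp_ge add_dot_add_le sq_sum_fld_dot_le fld_eq_zero_of_not_mem dot_self_nonneg
    green_setDecay dgreen_setDecay greenT_setDecay dgreenT_setDecay cR bl2n c0R delta0R c0R_pos delta0R_pos
    delta0R_admissible bsupp eq_zero_of_not_mem_bsupp bsuppDist bsuppDist_le bsuppDist_nonneg ctHyp_region
    cor23_pairings_set_region cor23_main_region pairings_set cR_pos
  covLap_biform projOp_biform)
open Literature.MathematicalPhysics.QuantumFieldTheory.Balaban1983to89.B4Cor23RegionDeltaAlg
  (extV resV extV_incl extV_of_not_mem fld_resV resV_extV extV_dotProduct dotProduct_extV extV_dotProduct_extV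
    fineDom_mono lnk trn regionOp_eq smulF fld_smulF dGv offL offL_dot_self_le offL_eq_zero_of
    dot_regionDeriv_resV dot_extV_regionDeriv_transpose fld_regionDeriv_resV_sq_le dot_dGv_eq_cutoff
    dot_extV_covDeriv_transpose)

noncomputable section

/-! ## §1  Elementary inequalities -/

section Elem

variable {d : ℕ} {ι : Type*} [Fintype ι] [DecidableEq ι] {R : Finset (Fin (d + 1) → ℤ)}

omit [DecidableEq ι] in
/-- `|⟨p,q⟩| ≤ ‖p‖‖q‖`. [folklore] -/
theorem abs_dot_le_sqrt {J : Type*} [Fintype J] (p q : J → ℝ) :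
    |p ⬝ᵥ q| ≤ Real.sqrt (p ⬝ᵥ p) * Real.sqrt (q ⬝ᵥ q) := by
  rw [← Real.sqrt_sq_eq_abs, ← Real.sqrt_mul (dotProduct_self_nonneg' p)]
  exact Real.sqrt_le_sqrt (dotProduct_sq_le p q)

omit [DecidableEq ι] in
/-- a site-sum Cauchy–Schwarz: `|Σ_{x∈S} ⟨Φ(x),Ψ(x)⟩| ≤ (Σ_{x∈S}|Φ(x)|²)^{1/2}(Σ_{x∈S}|Ψ(x)|²)^{1/2}`. [folklore] -/
theorem abs_sum_fld_dot_le (S : Finset ↥R) (Φ Ψ : ↥R × ι → ℝ) :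
    |∑ x ∈ S, fld Φ x ⬝ᵥ fld Ψ x|
      ≤ Real.sqrt (∑ x ∈ S, fld Φ x ⬝ᵥ fld Φ x) * Real.sqrt (∑ x ∈ S, fld Ψ x ⬝ᵥ fld Ψ x) := by
  rw [← Real.sqrt_sq_eq_abs, ← Real.sqrt_mul (Finset.sum_nonneg fun x _ => dotProduct_self_nonneg' _)]
  exact Real.sqrt_le_sqrt (sq_sum_fld_dot_le S Φ Ψ)

omit [DecidableEq ι] in
/-- a pairing against a configuration vanishing off `S` is a sum over `S`. [folklore] -/
theorem dot_eq_sum_of_vanish (Φ Ψ : ↥R × ι → ℝ) (S : Finset ↥R) (hΨ : ∀ x, x ∉ S → fld Ψ x = 0) :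
    Φ ⬝ᵥ Ψ = ∑ x ∈ S, fld Φ x ⬝ᵥ fld Ψ x := by
  rw [dotProduct_eq_sum_fld, ← Finset.sum_subset (Finset.subset_univ S)]
  intro x _ hx
  rw [hΨ x hx, dotProduct_zero]

omit [DecidableEq ι] in
/-- monotonicity of site sums of squares in the set. [folklore] -/
theorem sum_fld_sq_mono {S S' : Finset ↥R} (h : S ⊆ S') (Φ : ↥R × ι → ℝ) :
    ∑ x ∈ S, fld Φ x ⬝ᵥ fld Φ x ≤ ∑ x ∈ S', fld Φ x ⬝ᵥ fld Φ x :=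
  Finset.sum_le_sum_of_subset_of_nonneg h fun _ _ _ => dotProduct_self_nonneg' _

omit [DecidableEq ι] in
/-- a site sum of squares is below the full norm. [folklore] -/
theorem sum_fld_sq_le_dot (S : Finset ↥R) (Φ : ↥R × ι → ℝ) : ∑ x ∈ S, fld Φ x ⬝ᵥ fld Φ x ≤ Φ ⬝ᵥ Φ := by
  rw [dotProduct_eq_sum_fld Φ Φ]; exact sum_fld_sq_mono (Finset.subset_univ S) Φ

omit [DecidableEq ι] in
/-- `(Mp)·(Mq) = p·((MᵀM)q)`. [folklore] -/
theorem mulVec_dot_mulVec (M : Matrix ι ι ℝ) (p q : ι → ℝ) :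
    (M *ᵥ p) ⬝ᵥ (M *ᵥ q) = p ⬝ᵥ ((Mᵀ * M) *ᵥ q) := by
  rw [← Matrix.mulVec_mulVec, Matrix.dotProduct_mulVec p Mᵀ, Matrix.vecMul_transpose]

/-- orthogonal matrices preserve pairings. [folklore] -/
theorem orth_dot (M : Matrix ι ι ℝ) (hM : Mᵀ * M = 1) (p q : ι → ℝ) : (M *ᵥ p) ⬝ᵥ (M *ᵥ q) = p ⬝ᵥ q := by
  rw [mulVec_dot_mulVec, hM, Matrix.one_mulVec]

/-- `⟨f, MX⟩ = ⟨Mᵀf, X⟩`. [folklore] -/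
theorem dot_mulVec_eq_transpose_dot {J : Type*} [Fintype J] (M : Matrix J J ℝ) (f X : J → ℝ) :
    f ⬝ᵥ (M *ᵥ X) = (Mᵀ *ᵥ f) ⬝ᵥ X := by
  rw [Matrix.dotProduct_mulVec, Matrix.mulVec_transpose]

end Elem

/-! ## §2  The hypotheses of the abstract Combes–Thomas step with the coercivity constant `min(2,a)/4 + m²` -/

section Instance

variable {d : ℕ} {ι : Type*} [Fintype ι] [DecidableEq ι]

variable (F : OrthFlow ι) {ℓ : ℝ} (hℓ : 0 ≤ ℓ)
  (hLip : ∀ t (v : ι → ℝ), ((F.U t - 1) *ᵥ v) ⬝ᵥ ((F.U t - 1) *ᵥ v) ≤ (ℓ * t) ^ 2 * (v ⬝ᵥ v))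
  {e : ℝ} (he : 0 < e) {n : ℕ} (hn : 1 ≤ n) {a : ℝ} (ha : 0 < a) {m2 : ℝ} (hm : 0 ≤ m2)
  (Ωc : Finset (Fin (d + 1) → ℤ)) {Ac : (Fin (d + 1) → ℤ) → Fin (d + 1) → ℝ} {c β : ℝ} (hc : 0 ≤ c)
  (h17 : ∀ x ∈ fineDom n Ωc, ∀ μ ν : Fin (d + 1), |Ac (x + e1 μ) ν - Ac x ν| ≤ c * e ^ (β - 1) / n)
  (hsmall : ℓ ^ 2 * ((d + 1) * c * e ^ β) ^ 2 * (d + 1) * (1 + a * (d + 1)) ≤ min 2 a / 4)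

include hℓ hLip he ha hm hc h17 hsmall

/-- **THE HYPOTHESES OF THE ABSTRACT STEP WITH MASS IN THE COERCIVITY CONSTANT**: [B4]'s region operator satisfies
`B4Cor23Region.CTHyp` with `σ = min(2,a)/4 + m²` (the full (1.8) on the region, `B4Lemma21Region.regionOp_form_ge`)
and any `0 ≤ δ ≤ 1` with `2(d+1)δ² + a(e^δ − 1) ≤ min(2,a)/8` — so that the set-to-set decay constants of
`B4Cor23Region` §D carry `1/(min(2,a)/4 + m²)`, uniformly in the mass.
[cite: Balaban1983RegularityDecay, p. 573 (1.8), p. 580 (2.29)] -/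
theorem ctHyp_region_mass {δ : ℝ} (hδ0 : 0 ≤ δ) (hδ1 : δ ≤ 1)
    (hct : 2 * ((d : ℝ) + 1) * δ ^ 2 + a * (Real.exp δ - 1) ≤ min 2 a / 8) :
    CTHyp n (fineDom n Ωc) (regionOp F e hn a m2 Ωc Ac)
      (fieldLink F (e / n) fun u v : ↥(fineDom n Ωc) => compField Ac u.1 v.1) (min 2 a / 4 + m2) δ where
  one_le := hn
  pos := add_pos_of_pos_of_nonneg (div_pos (lt_min two_pos ha) four_pos) hm
  coercive Φ := regionOp_form_ge F hℓ hLip he hn ha Ωc hc h17 hsmall Φ (m2 := m2)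
  deriv μ Φ := regionDeriv_sq_le_form F e hn ha.le hm Ωc Ac μ Φ
  orth x y := F.orth _
  nonneg := hδ0
  le_one := hδ1
  err T hT w := by
    have h := cerr_regionOp_ge F e hn ha.le m2 Ωc Ac hδ0 hδ1 (ctw n (fineDom n Ωc) δ T hT)
      (fun x y => abs_ctw_sub_le hδ0 T hT x y) w
    have hww := dot_self_nonneg w
    have hmin : 0 < min 2 a := lt_min two_pos ha
    nlinarith

end Instance

/-! ## §3  Geometry of nested regions: boundary distances of `R^N`-valued configurations, distance levels, the cutoff -/

section Geometry

variable {d : ℕ} {ι : Type*} [Fintype ι] [DecidableEq ι] {n : ℕ} {R R₀ : Finset (Fin (d + 1) → ℤ)}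

/-- **`dist_η(supp f, Ω₀∖Ω)`** for an `R^N`-valued configuration on `Ω`, measured inside `Ω₀` (`0` if `supp f` or
`Ω₀∖Ω` has no fine point).  Since `Ω₀∖Ω ⊆ Ω^c` this is `≥ dist(supp f, Ω^c)` of the printed corollary.
[cite: Balaban1983RegularityDecay, p. 581, Corollary 2.3, «e^{−δ₀(dist(supp f,Ω^c) + dist(supp f',Ω^c))}»] -/
def bdistV (n : ℕ) (h : R ⊆ R₀) (f : ↥R × ι → ℝ) : ℝ :=
  setDist (edistR n R₀) ((bsupp f).map (inclEmb h)) (outR R R₀)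

omit [DecidableEq ι] in
/-- `dist_η(supp f, Ω₀∖Ω) ≥ 0`. [folklore] -/
theorem bdistV_nonneg (h : R ⊆ R₀) (f : ↥R × ι → ℝ) : 0 ≤ bdistV n h f := by
  unfold bdistV setDist
  split_ifs with hne
  · exact Finset.le_inf' hne _ fun p _ => edistR_nonneg p.1 p.2
  · exact le_rfl

omit [DecidableEq ι] in
/-- without fine points in `Ω₀∖Ω` the boundary distance is `0` by convention. [folklore] -/
theorem bdistV_eq_zero (h : R ⊆ R₀) (f : ↥R × ι → ℝ) (hout : ¬ (outR R R₀).Nonempty) : bdistV n h f = 0 := by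
  unfold bdistV setDist
  rw [dif_neg]
  rintro ⟨p, hp⟩
  exact hout ⟨p.2, (Finset.mem_product.1 hp).2⟩

omit [DecidableEq ι] in
/-- `dist_η(supp f, Ω₀∖Ω) ≤ dist_η(x, Ω₀∖Ω)` for `x ∈ supp f`. [folklore] -/
theorem bdistV_le_dout (h : R ⊆ R₀) (hout : (outR R R₀).Nonempty) (f : ↥R × ι → ℝ) {x : ↥R}
    (hx : x ∈ bsupp f) : bdistV n h f ≤ dout n hout (incl h x) := by
  obtain ⟨z, hz, hzeq⟩ := exists_dout_eq hout (incl h x)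
  rw [hzeq]
  exact setDist_le _ (Finset.mem_map_of_mem (inclEmb h) hx) hz

/-- **THE DISTANCE LEVELS** `S_r = {x ∈ Ω : dist_η(x, Ω₀∖Ω) ≤ r}` (the collar of `B4Cor23ZeroDelta` is `S_3`). [folklore] -/
def lev (n : ℕ) (h : R ⊆ R₀) (hout : (outR R R₀).Nonempty) (r : ℝ) : Finset ↥R :=
  Finset.univ.filter fun x => dout n hout (incl h x) ≤ r

/-- membership in a level. [folklore] -/
theorem mem_lev {h : R ⊆ R₀} {hout : (outR R R₀).Nonempty} {r : ℝ} {x : ↥R} :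
    x ∈ lev n h hout r ↔ dout n hout (incl h x) ≤ r := by simp [lev]

/-- the levels increase. [folklore] -/
theorem lev_mono (h : R ⊆ R₀) (hout : (outR R R₀).Nonempty) {r s : ℝ} (hrs : r ≤ s) :
    lev n h hout r ⊆ lev n h hout s := fun _ hx => mem_lev.2 ((mem_lev.1 hx).trans hrs)

/-- a point within `dist_η ≤ s` of level `r` lies in level `r + s`. [folklore] -/
theorem mem_lev_of_edistR_le {h : R ⊆ R₀} {hout : (outR R R₀).Nonempty} {r s : ℝ} {x y : ↥R}
    (hx : x ∈ lev n h hout r) (hxy : edistR n R x y ≤ s) : y ∈ lev n h hout (r + s) := by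
  rw [mem_lev] at hx ⊢
  have hd := abs_dout_sub_le (n := n) hout (incl h y) (incl h x)
  rw [edistR_incl, edistR_comm, abs_le] at hd
  linarith [hd.2]

omit [DecidableEq ι] in
/-- **LEVELS ARE FAR FROM DEEP SUPPORTS**: `dist_η(x, t) ≥ dist_η(supp f', Ω₀∖Ω) − r` for `x ∈ S_r`, `t ∈ supp f'`.
[folklore] -/
theorem le_edistR_of_mem_lev {h : R ⊆ R₀} {hout : (outR R R₀).Nonempty} {r : ℝ} {x : ↥R}
    (hx : x ∈ lev n h hout r) (g : ↥R × ι → ℝ) {t : ↥R} (ht : t ∈ bsupp g) :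
    bdistV n h g - r ≤ edistR n R x t := by
  obtain ⟨z, hz, hzeq⟩ := exists_dout_eq hout (incl h x)
  have h1 : bdistV n h g ≤ edistR n R₀ (incl h t) z := setDist_le _ (Finset.mem_map_of_mem (inclEmb h) ht) hz
  have h2 := edistR_triangle (n := n) (incl h t) (incl h x) z
  rw [edistR_incl, edistR_comm t x] at h2
  have h3 := mem_lev.1 hx
  linarith

/-- nearest neighbours are at `dist_η ≤ 1`. [folklore] -/
theorem edistR_le_one_of_mem_nbrs (hn : 1 ≤ n) {x y : ↥R} (hxy : y.1 ∈ nbrs x.1) : edistR n R x y ≤ 1 := by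
  have hn0 : (0 : ℝ) < n := by exact_mod_cast hn
  refine (edistR_le_of_mem_nbrs hn hxy).trans ?_
  rw [div_le_one hn0]; exact_mod_cast hn

/-- the forward `μ`-neighbour is at `dist_η ≤ 1`. [folklore] -/
theorem edistR_fwd_le_one (hn : 1 ≤ n) (μ : Fin (d + 1)) (x : ↥R) (hx : x.1 + e1 μ ∈ R) :
    edistR n R x ⟨x.1 + e1 μ, hx⟩ ≤ 1 :=
  edistR_le_one_of_mem_nbrs hn (mem_nbrs.2 ⟨μ, Or.inl rfl⟩)

/-- points of one unit block are at `dist_η ≤ 1`. [folklore] -/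
theorem edistR_le_one_of_blk_eq (hn : 1 ≤ n) {x y : ↥R} (hb : blk n x.1 = blk n y.1) : edistR n R x y ≤ 1 := by
  have hn0 : (0 : ℝ) < n := by exact_mod_cast hn
  unfold edistR
  calc 1 / (n : ℝ) * supNorm (x.1 - y.1) ≤ 1 / (n : ℝ) * ((n : ℝ) - 1) :=
        mul_le_mul_of_nonneg_left (supNorm_sub_le_of_blk_eq hn hb) (by positivity)
    _ ≤ 1 := by rw [div_mul_eq_mul_div, one_mul, div_le_one hn0]; linarith

/-- **THE CUTOFF `θ = 1 − χ`** (`χ` = `B4Cor23ZeroDelta.cutF`): `θ = 1` on the boundary layer, `θ = 0` beyond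
`dist_η(·,Ω₀∖Ω) > 2`, values in `[0,1]`, `1`-Lipschitz for `dist_η`. [folklore] -/
def thF (n : ℕ) (h : R ⊆ R₀) (hout : (outR R R₀).Nonempty) (x : ↥R) : ℝ := 1 - cutF n h hout x

/-- `θ ≥ 0`. [folklore] -/
theorem thF_nonneg (h : R ⊆ R₀) (hout : (outR R R₀).Nonempty) (x : ↥R) : 0 ≤ thF n h hout x := by
  unfold thF; linarith [cutF_le_one (n := n) h hout x]

/-- `θ ≤ 1`. [folklore] -/
theorem thF_le_one (h : R ⊆ R₀) (hout : (outR R R₀).Nonempty) (x : ↥R) : thF n h hout x ≤ 1 := by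
  unfold thF; linarith [cutF_nonneg (n := n) h hout x]

/-- `|θ| ≤ 1`. [folklore] -/
theorem abs_thF_le_one (h : R ⊆ R₀) (hout : (outR R R₀).Nonempty) (x : ↥R) : |thF n h hout x| ≤ 1 :=
  abs_le.2 ⟨by linarith [thF_nonneg (n := n) h hout x], thF_le_one h hout x⟩

/-- `θ` is `1`-Lipschitz for `dist_η`. [folklore] -/
theorem abs_thF_sub_le (h : R ⊆ R₀) (hout : (outR R R₀).Nonempty) (x y : ↥R) :
    |thF n h hout x - thF n h hout y| ≤ edistR n R x y := by
  unfold thF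
  rw [show (1 - cutF n h hout x) - (1 - cutF n h hout y) = cutF n h hout y - cutF n h hout x by ring, abs_sub_comm]
  exact abs_cutF_sub_le h hout x y

/-- `θ = 1` on the boundary layer. [folklore] -/
theorem thF_eq_one_of_mem_bdR (hn : 1 ≤ n) (h : R ⊆ R₀) (hout : (outR R R₀).Nonempty) {y : ↥R}
    (hy : y ∈ bdR R R₀) : thF n h hout y = 1 := by
  unfold thF; rw [cutF_eq_zero_of_mem_bdR hn h hout hy, sub_zero]

/-- `{θ ≠ 0} ⊆ S_3`. [folklore] -/
theorem mem_lev_of_thF_ne_zero (hn : 1 ≤ n) (h : R ⊆ R₀) (hout : (outR R R₀).Nonempty) {x : ↥R}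
    (hx : thF n h hout x ≠ 0) : x ∈ lev n h hout 3 := by
  have h1 : cutF n h hout x ≠ 1 := fun h1 => hx (by unfold thF; rw [h1, sub_self])
  exact mem_lev.2 (mem_collar.1 (mem_collar_of_cutF_ne_one hn h hout h1))

/-- the jump set of `θ` at scale `dist_η ≤ 1` lies in `S_3`. [folklore] -/
theorem mem_lev_of_thF_jump (hn : 1 ≤ n) (h : R ⊆ R₀) (hout : (outR R R₀).Nonempty) {x y : ↥R}
    (hxy : edistR n R x y ≤ 1) (hj : thF n h hout x ≠ thF n h hout y) : x ∈ lev n h hout 3 := by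
  have h1 : cutF n h hout x ≠ cutF n h hout y := fun h1 => hj (by unfold thF; rw [h1])
  exact mem_lev.2 (mem_collar.1 (mem_collar_of_jump hn h hout hxy h1))

end Geometry

/-! ## §4  The covariant Leibniz rule for a site multiplier and the multiplied test functions -/

section Leibniz

variable {d : ℕ} {ι : Type*} [Fintype ι] [DecidableEq ι] {n : ℕ} {R : Finset (Fin (d + 1) → ℤ)}

/-- the value of a site function at the forward `μ`-neighbour (`0` outside the region). [folklore] -/
def shF (μ : Fin (d + 1)) (θ : ↥R → ℝ) (x : ↥R) : ℝ :=
  if h : x.1 + e1 μ ∈ R then θ ⟨x.1 + e1 μ, h⟩ else 0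

/-- the scaled jump `η^{-1}(θ(x + ηe_μ) − θ(x))` of a site function along the bond `⟨x, x+ηe_μ⟩` (`0` if the bond
leaves the region). [folklore] -/
def jmpF (n : ℕ) (μ : Fin (d + 1)) (θ : ↥R → ℝ) (x : ↥R) : ℝ :=
  if h : x.1 + e1 μ ∈ R then (n : ℝ) * (θ ⟨x.1 + e1 μ, h⟩ - θ x) else 0

/-- **THE COVARIANT LEIBNIZ RULE**: `(D^η_{W,μ}(θΦ))(x) = θ(x+ηe_μ)·(D^η_{W,μ}Φ)(x) + η^{-1}(θ(x+ηe_μ) − θ(x))·Φ(x)`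
(the link variable acts on the field index only, so it commutes with the site multiplier). [folklore] -/
theorem fld_covDeriv_smulF (W : ↥R → ↥R → Matrix ι ι ℝ) (μ : Fin (d + 1)) (θ : ↥R → ℝ) (Φ : ↥R × ι → ℝ)
    (x : ↥R) :
    fld (covDeriv n R W μ *ᵥ smulF θ Φ) x
      = shF μ θ x • fld (covDeriv n R W μ *ᵥ Φ) x + jmpF n μ θ x • fld Φ x := by
  by_cases h : x.1 + e1 μ ∈ R
  · rw [fld_covDeriv_mulVec_of_mem n W (smulF θ Φ) h, fld_covDeriv_mulVec_of_mem n W Φ h, shF, dif_pos h, jmpF,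
      dif_pos h,
      fld_smulF, fld_smulF, Matrix.mulVec_smul]
    funext i
    simp only [Pi.smul_apply, Pi.sub_apply, Pi.add_apply, smul_eq_mul]
    ring
  · rw [fld_covDeriv_mulVec_of_not_mem n W (smulF θ Φ) h, fld_covDeriv_mulVec_of_not_mem n W Φ h, shF, dif_neg h,
      jmpF, dif_neg h]
    simp

omit [DecidableEq ι] in
/-- moving a site multiplier across a pairing: `⟨f, θΦ⟩ = ⟨θf, Φ⟩`. [folklore] -/
theorem dot_smulF (θ : ↥R → ℝ) (f Φ : ↥R × ι → ℝ) : f ⬝ᵥ smulF θ Φ = smulF θ f ⬝ᵥ Φ := by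
  simp only [dotProduct, smulF]
  exact Finset.sum_congr rfl fun j _ => by ring

/-- **THE PAIRING FORM OF THE LEIBNIZ RULE**: `⟨f, D^η_{W,μ}(θΦ)⟩ = ⟨θ(·+ηe_μ)f, D^η_{W,μ}Φ⟩ + ⟨η^{-1}(δ_μθ)f, Φ⟩`.
[folklore] -/
theorem dot_covDeriv_smulF (W : ↥R → ↥R → Matrix ι ι ℝ) (μ : Fin (d + 1)) (θ : ↥R → ℝ) (f Φ : ↥R × ι → ℝ) :
    f ⬝ᵥ (covDeriv n R W μ *ᵥ smulF θ Φ)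
      = smulF (shF μ θ) f ⬝ᵥ (covDeriv n R W μ *ᵥ Φ) + smulF (jmpF n μ θ) f ⬝ᵥ Φ := by
  rw [dotProduct_eq_sum_fld f, dotProduct_eq_sum_fld (smulF (shF μ θ) f), dotProduct_eq_sum_fld (smulF (jmpF n μ θ) f),
    ← Finset.sum_add_distrib]
  refine Finset.sum_congr rfl fun x _ => ?_
  rw [fld_covDeriv_smulF, fld_smulF, fld_smulF, dotProduct_add, dotProduct_smul, dotProduct_smul, smul_dotProduct,
    smul_dotProduct]

omit [DecidableEq ι] in
/-- a multiplier with `|ζ| ≤ 1` does not increase the norm. [folklore] -/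
theorem smulF_dot_self_le (ζ : ↥R → ℝ) (hζ : ∀ x, |ζ x| ≤ 1) (f : ↥R × ι → ℝ) :
    smulF ζ f ⬝ᵥ smulF ζ f ≤ f ⬝ᵥ f := by
  simp only [dotProduct, smulF]
  refine Finset.sum_le_sum fun j _ => ?_
  have h1 := hζ j.1
  have h2 : ζ j.1 ^ 2 ≤ 1 := by
    have := abs_le.1 h1
    nlinarith
  nlinarith [mul_self_nonneg (f j)]

omit [DecidableEq ι] in
/-- `‖ζf‖₂ ≤ ‖f‖₂` for `|ζ| ≤ 1`. [folklore] -/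
theorem bl2n_smulF_le (ζ : ↥R → ℝ) (hζ : ∀ x, |ζ x| ≤ 1) (f : ↥R × ι → ℝ) : bl2n (smulF ζ f) ≤ bl2n f :=
  Real.sqrt_le_sqrt (smulF_dot_self_le ζ hζ f)

omit [DecidableEq ι] in
/-- the support of `ζf` lies in `supp f ∩ {ζ ≠ 0}`. [folklore] -/
theorem mem_bsupp_smulF {ζ : ↥R → ℝ} {f : ↥R × ι → ℝ} {x : ↥R} (hx : x ∈ bsupp (smulF ζ f)) :
    x ∈ bsupp f ∧ ζ x ≠ 0 := by
  have h1 : fld (smulF ζ f) x ≠ 0 := (Finset.mem_filter.1 hx).2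
  rw [fld_smulF] at h1
  refine ⟨Finset.mem_filter.2 ⟨Finset.mem_univ _, fun h0 => h1 ?_⟩, fun h0 => h1 ?_⟩
  · rw [h0, smul_zero]
  · rw [h0, zero_smul]

/-- `|θ(x + ηe_μ)| ≤ 1` for `|θ| ≤ 1`. [folklore] -/
theorem abs_shF_le_one (μ : Fin (d + 1)) {θ : ↥R → ℝ} (hθ : ∀ x, |θ x| ≤ 1) (x : ↥R) : |shF μ θ x| ≤ 1 := by
  unfold shF; split_ifs
  · exact hθ _
  · simp

/-- the scaled jump of a `dist_η`-`1`-Lipschitz site function is at most `1`. [folklore] -/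
theorem abs_jmpF_le_one (hn : 1 ≤ n) (μ : Fin (d + 1)) {θ : ↥R → ℝ}
    (hθ : ∀ x y : ↥R, |θ x - θ y| ≤ edistR n R x y) (x : ↥R) : |jmpF n μ θ x| ≤ 1 := by
  have hn0 : (0 : ℝ) < n := by exact_mod_cast hn
  unfold jmpF; split_ifs with h
  · rw [abs_mul, abs_of_pos hn0]
    have h1 : |θ ⟨x.1 + e1 μ, h⟩ - θ x| ≤ 1 / (n : ℝ) :=
      (hθ ⟨x.1 + e1 μ, h⟩ x).trans (by rw [edistR_comm]; exact edistR_le_of_mem_nbrs hn (mem_nbrs.2 ⟨μ, Or.inl rfl⟩))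
    calc (n : ℝ) * |θ ⟨x.1 + e1 μ, h⟩ - θ x| ≤ (n : ℝ) * (1 / (n : ℝ)) := mul_le_mul_of_nonneg_left h1 hn0.le
      _ = 1 := by rw [mul_one_div, div_self hn0.ne']
  · simp

/-- **THE LEIBNIZ RULE, SQUARED, SITEWISE**: `|(D^η_{W,μ}(θΦ))(x)|² ≤ 2(|(D^η_{W,μ}Φ)(x)|² + |Φ(x)|²)` for `|θ| ≤ 1`
with scaled jumps `≤ 1`. [folklore] -/
theorem fld_covDeriv_smulF_sq_le (W : ↥R → ↥R → Matrix ι ι ℝ) (μ : Fin (d + 1)) {θ : ↥R → ℝ}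
    (hθ : ∀ x, |θ x| ≤ 1) (hj : ∀ x, |jmpF n μ θ x| ≤ 1) (Φ : ↥R × ι → ℝ) (x : ↥R) :
    fld (covDeriv n R W μ *ᵥ smulF θ Φ) x ⬝ᵥ fld (covDeriv n R W μ *ᵥ smulF θ Φ) x
      ≤ 2 * (fld (covDeriv n R W μ *ᵥ Φ) x ⬝ᵥ fld (covDeriv n R W μ *ᵥ Φ) x + fld Φ x ⬝ᵥ fld Φ x) := by
  rw [fld_covDeriv_smulF]
  set A := fld (covDeriv n R W μ *ᵥ Φ) x
  set B := fld Φ x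
  set s := shF μ θ x
  set t := jmpF n μ θ x
  have hs : s ^ 2 ≤ 1 := by have := abs_le.1 (abs_shF_le_one μ hθ x); nlinarith
  have ht : t ^ 2 ≤ 1 := by have := abs_le.1 (hj x); nlinarith
  have hA := dotProduct_self_nonneg' A
  have hB := dotProduct_self_nonneg' B
  calc (s • A + t • B) ⬝ᵥ (s • A + t • B) ≤ 2 * ((s • A) ⬝ᵥ (s • A) + (t • B) ⬝ᵥ (t • B)) := add_dot_add_le _ _
    _ = 2 * (s ^ 2 * (A ⬝ᵥ A) + t ^ 2 * (B ⬝ᵥ B)) := by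
        simp only [smul_dotProduct, dotProduct_smul, smul_eq_mul]; ring
    _ ≤ 2 * (A ⬝ᵥ A + B ⬝ᵥ B) := by nlinarith

/-- where the multiplier vanishes at `x` and at `x + ηe_μ`, so does `D^η_{W,μ}(θΦ)` at `x`. [folklore] -/
theorem fld_covDeriv_smulF_eq_zero (W : ↥R → ↥R → Matrix ι ι ℝ) (μ : Fin (d + 1)) {θ : ↥R → ℝ}
    (Φ : ↥R × ι → ℝ) {x : ↥R} (hx : θ x = 0) (hx' : ∀ h : x.1 + e1 μ ∈ R, θ ⟨x.1 + e1 μ, h⟩ = 0) :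
    fld (covDeriv n R W μ *ᵥ smulF θ Φ) x = 0 := by
  rw [fld_covDeriv_smulF]
  have h1 : shF μ θ x = 0 := by unfold shF; split_ifs with h; exacts [hx' h, rfl]
  have h2 : jmpF n μ θ x = 0 := by
    unfold jmpF; split_ifs with h
    · rw [hx' h, hx, sub_zero, mul_zero]
    · rfl
  rw [h1, h2, zero_smul, zero_smul, add_zero]

end Leibniz

/-! ## §5  `−Δ^{η,N}_{A,Ω} = Σ_μ D^{η*}_{A,μ}D^η_{A,μ}` as bilinear forms ((1.3) polarised) -/

section LapSum

variable {d : ℕ} {ι : Type*} [Fintype ι] [DecidableEq ι] {n : ℕ} {R : Finset (Fin (d + 1) → ℤ)}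

/-- **THE BILINEAR FORM OF `D^{η*}_{W,μ}D^η_{W,μ}`**: `⟨D_μΨ, D_μΦ⟩ = Σ_{x,y} dirWt_μ(x,y)·⟨Wψ(y) − ψ(x), Wφ(y) − φ(x)⟩`.
[cite: Balaban1983RegularityDecay, p. 572 (1.3)] [folklore] -/
theorem covDeriv_biform (n : ℕ) (R : Finset (Fin (d + 1) → ℤ)) (W : ↥R → ↥R → Matrix ι ι ℝ) (μ : Fin (d + 1))
    (Ψ Φ : ↥R × ι → ℝ) :
    (covDeriv n R W μ *ᵥ Ψ) ⬝ᵥ (covDeriv n R W μ *ᵥ Φ)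
      = ∑ x, ∑ y, dirWt n R μ x y * ((W x y *ᵥ fld Ψ y - fld Ψ x) ⬝ᵥ (W x y *ᵥ fld Φ y - fld Φ x)) := by
  rw [dotProduct_eq_sum_fld]
  refine Finset.sum_congr rfl fun x _ => ?_
  by_cases h : x.1 + e1 μ ∈ R
  · rw [fld_covDeriv_mulVec_of_mem n W Ψ h, fld_covDeriv_mulVec_of_mem n W Φ h, Finset.sum_eq_single ⟨x.1 + e1 μ, h⟩]
    · rw [dirWt, if_pos rfl, smul_dotProduct, dotProduct_smul, smul_eq_mul, smul_eq_mul]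
      ring
    · intro y _ hy
      rw [dirWt, if_neg, zero_mul]
      intro hy1
      exact hy (Subtype.ext hy1)
    · intro hh; exact absurd (Finset.mem_univ _) hh
  · rw [fld_covDeriv_mulVec_of_not_mem n W Ψ h, zero_dotProduct]
    symm
    refine Finset.sum_eq_zero fun y _ => ?_
    rw [dirWt, if_neg, zero_mul]
    intro hy1
    exact h (hy1 ▸ y.2)

/-- reversing an orthogonal bond in a bilinear bond term: `⟨Wᵀu − v, Wᵀu' − v'⟩ = ⟨Wv − u, Wv' − u'⟩`. [folklore] -/
theorem bond_biform_rev {W₁ W₂ : Matrix ι ι ℝ} (hT : W₂ = W₁ᵀ) (hO : W₁ᵀ * W₁ = 1) (u u' v v' : ι → ℝ) :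
    (W₂ *ᵥ u - v) ⬝ᵥ (W₂ *ᵥ u' - v') = (W₁ *ᵥ v - u) ⬝ᵥ (W₁ *ᵥ v' - u') := by
  subst hT
  have hO' : W₁ * W₁ᵀ = 1 := mul_eq_one_comm.1 hO
  have h1 : ∀ p q : ι → ℝ, W₁ᵀ *ᵥ p - q = W₁ᵀ *ᵥ (p - W₁ *ᵥ q) := by
    intro p q; rw [Matrix.mulVec_sub, Matrix.mulVec_mulVec, hO, Matrix.one_mulVec]
  have hO'' : (W₁ᵀ)ᵀ * W₁ᵀ = 1 := by rw [Matrix.transpose_transpose]; exact hO'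
  rw [h1, h1, orth_dot _ hO'', ← neg_sub (W₁ *ᵥ v) u, ← neg_sub (W₁ *ᵥ v') u', neg_dotProduct, dotProduct_neg,
    neg_neg]

/-- **THE (1.3) WEIGHTS ARE THE SYMMETRISED DIRECTIONAL WEIGHTS**: `regWt(x,y) = ½ Σ_μ (dirWt_μ(x,y) + dirWt_μ(y,x))`
(a nearest-neighbour pair is the bond `⟨x, x+e_μ⟩` or `⟨y, y+e_μ⟩` for exactly one `μ`).
[cite: Balaban1983RegularityDecay, p. 572 (1.3), dictionary] [folklore] -/
theorem regWt_eq_half_sum_dirWt (n : ℕ) (R : Finset (Fin (d + 1) → ℤ)) (x y : ↥R) :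
    regWt n R x y = 1 / 2 * ∑ μ, (dirWt n R μ x y + dirWt n R μ y x) := by
  unfold regWt dirWt
  by_cases hy : y.1 ∈ nbrs x.1
  · rw [if_pos hy]
    obtain ⟨μ₀, hμ₀⟩ := mem_nbrs.1 hy
    rcases hμ₀ with h0 | h0
    · have h0' : y.1 = x.1 + e1 μ₀ := h0
      have A : ∀ μ, (if y.1 = x.1 + e1 μ then (n : ℝ) ^ 2 else 0) = if μ = μ₀ then (n : ℝ) ^ 2 else 0 := by
        intro μ
        by_cases hμ : μ = μ₀
        · rw [if_pos hμ, if_pos (by rw [hμ]; exact h0')]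
        · rw [if_neg hμ, if_neg]
          intro h1
          rw [h0'] at h1
          exact hμ (e1_inj.1 (add_left_cancel h1)).symm
      have B : ∀ μ, (if x.1 = y.1 + e1 μ then (n : ℝ) ^ 2 else 0) = 0 := by
        intro μ
        rw [if_neg]
        intro h1
        rw [h0'] at h1
        exact ne_add_e1_add_e1 x.1 μ₀ μ h1
      simp_rw [A, B, add_zero]
      rw [Finset.sum_ite_eq' Finset.univ μ₀, if_pos (Finset.mem_univ _)]
      ring
    · have h0' : x.1 = y.1 + e1 μ₀ := by rw [h0]; exact (sub_add_cancel _ _).symm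
      have A : ∀ μ, (if x.1 = y.1 + e1 μ then (n : ℝ) ^ 2 else 0) = if μ = μ₀ then (n : ℝ) ^ 2 else 0 := by
        intro μ
        by_cases hμ : μ = μ₀
        · rw [if_pos hμ, if_pos (by rw [hμ]; exact h0')]
        · rw [if_neg hμ, if_neg]
          intro h1
          rw [h0'] at h1
          exact hμ (e1_inj.1 (add_left_cancel h1)).symm
      have B : ∀ μ, (if y.1 = x.1 + e1 μ then (n : ℝ) ^ 2 else 0) = 0 := by
        intro μ
        rw [if_neg]
        intro h1
        rw [h0'] at h1
        exact ne_add_e1_add_e1 y.1 μ₀ μ h1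
      simp_rw [A, B, zero_add]
      rw [Finset.sum_ite_eq' Finset.univ μ₀, if_pos (Finset.mem_univ _)]
      ring
  · rw [if_neg hy]
    have A : ∀ μ, (if y.1 = x.1 + e1 μ then (n : ℝ) ^ 2 else 0) = 0 := by
      intro μ; rw [if_neg]; intro h1; exact hy (mem_nbrs.2 ⟨μ, Or.inl h1⟩)
    have B : ∀ μ, (if x.1 = y.1 + e1 μ then (n : ℝ) ^ 2 else 0) = 0 := by
      intro μ; rw [if_neg]; intro h1; exact hy (mem_nbrs.2 ⟨μ, Or.inr (eq_sub_of_add_eq h1.symm)⟩)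
    simp_rw [A, B, add_zero, Finset.sum_const_zero]
    ring

/-- **`⟨Ψ, (−Δ^{η,N}_{W})Φ⟩ = Σ_μ ⟨D^η_{W,μ}Ψ, D^η_{W,μ}Φ⟩`** for orthogonal link variables reversing by
transposition (`W(y,x) = W(x,y)ᵀ`, as `U(A_b)` for a vector field): the covariant Laplacian of (1.3) IS the sum of
the `D^*D` over the directions, as bilinear forms. [cite: Balaban1983RegularityDecay, p. 572 (1.3)] [folklore] -/
theorem covLap_biform_eq_sum (n : ℕ) (R : Finset (Fin (d + 1) → ℤ)) {W : ↥R → ↥R → Matrix ι ι ℝ}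
    (hT : ∀ x y : ↥R, y.1 ∈ nbrs x.1 → W y x = (W x y)ᵀ) (hO : ∀ x y : ↥R, (W x y)ᵀ * W x y = 1)
    (Ψ Φ : ↥R × ι → ℝ) :
    Ψ ⬝ᵥ (covLap (regWt n R) W *ᵥ Φ) = ∑ μ, (covDeriv n R W μ *ᵥ Ψ) ⬝ᵥ (covDeriv n R W μ *ᵥ Φ) := by
  set b : ↥R → ↥R → ℝ := fun x y => (W x y *ᵥ fld Ψ y - fld Ψ x) ⬝ᵥ (W x y *ᵥ fld Φ y - fld Φ x) with hb
  have hcov : ∀ μ, (covDeriv n R W μ *ᵥ Ψ) ⬝ᵥ (covDeriv n R W μ *ᵥ Φ) = ∑ x, ∑ y, dirWt n R μ x y * b x y :=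
    fun μ => covDeriv_biform n R W μ Ψ Φ
  have hsym : ∀ (μ : Fin (d + 1)) (x y : ↥R), dirWt n R μ y x * b x y = dirWt n R μ y x * b y x := by
    intro μ x y
    by_cases h : x.1 = y.1 + e1 μ
    · have hn' : x.1 ∈ nbrs y.1 := mem_nbrs.2 ⟨μ, Or.inl h⟩
      rw [hb]
      simp only
      rw [bond_biform_rev (hT y x hn') (hO y x)]
    · simp only [dirWt, if_neg h, zero_mul]
  have hswap : ∀ μ : Fin (d + 1), ∑ x, ∑ y, dirWt n R μ y x * b x y = ∑ x, ∑ y, dirWt n R μ x y * b x y := by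
    intro μ
    rw [Finset.sum_comm]
    exact Finset.sum_congr rfl fun y _ => Finset.sum_congr rfl fun x _ => hsym μ x y
  rw [covLap_biform]
  calc ∑ x, ∑ y, regWt n R x y * b x y
      = ∑ x, ∑ y, ∑ μ, 1 / 2 * (dirWt n R μ x y * b x y + dirWt n R μ y x * b x y) := by
        refine Finset.sum_congr rfl fun x _ => Finset.sum_congr rfl fun y _ => ?_
        rw [regWt_eq_half_sum_dirWt, Finset.mul_sum, Finset.sum_mul]
        exact Finset.sum_congr rfl fun μ _ => by ring
    _ = ∑ x, ∑ μ, ∑ y, 1 / 2 * (dirWt n R μ x y * b x y + dirWt n R μ y x * b x y) :=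
        Finset.sum_congr rfl fun x _ => Finset.sum_comm
    _ = ∑ μ, ∑ x, ∑ y, 1 / 2 * (dirWt n R μ x y * b x y + dirWt n R μ y x * b x y) := Finset.sum_comm
    _ = ∑ μ, ((1 / 2) * (∑ x, ∑ y, dirWt n R μ x y * b x y) + (1 / 2) * (∑ x, ∑ y, dirWt n R μ y x * b x y)) := by
        refine Finset.sum_congr rfl fun μ _ => ?_
        rw [Finset.mul_sum, Finset.mul_sum, ← Finset.sum_add_distrib]
        refine Finset.sum_congr rfl fun x _ => ?_
        rw [Finset.mul_sum, Finset.mul_sum, ← Finset.sum_add_distrib]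
        exact Finset.sum_congr rfl fun y _ => by ring
    _ = ∑ μ, (covDeriv n R W μ *ᵥ Ψ) ⬝ᵥ (covDeriv n R W μ *ᵥ Φ) := by
        refine Finset.sum_congr rfl fun μ _ => ?_
        rw [hswap μ, hcov μ]; ring

end LapSum

/-! ## §6  The averaging term: `|⟨v, Q^*Q w⟩| ≤ n^{d+1}(Σ_{S'}|v|²)^{1/2}‖w‖₂` for `w` supported in `S` and `S'` the
blocks meeting `S` -/

section Proj

variable {d : ℕ} {ι : Type*} [Fintype ι] [DecidableEq ι] {n : ℕ}

/-- one averaged value, squared: `|(QΦ)(y)|² ≤ n^{d+1} Σ_x q(y,x)|Φ(x)|²` for orthogonal transporters and the block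
weights of a union of unit blocks. [folklore] -/
theorem fld_avgOp_sq_le (hn : 1 ≤ n) (Ωc : Finset (Fin (d + 1) → ℤ))
    (T : ↥Ωc → ↥(fineDom n Ωc) → Matrix ι ι ℝ) (hT : ∀ y x, (T y x)ᵀ * T y x = 1)
    (Φ : ↥(fineDom n Ωc) × ι → ℝ) (y : ↥Ωc) :
    fld (avgOp (rBlkWt n Ωc (fineDom n Ωc)) T *ᵥ Φ) y ⬝ᵥ fld (avgOp (rBlkWt n Ωc (fineDom n Ωc)) T *ᵥ Φ) y
      ≤ (n : ℝ) ^ (d + 1) * ∑ x, rBlkWt n Ωc (fineDom n Ωc) y x * (fld Φ x ⬝ᵥ fld Φ x) := by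
  rw [fld_avgOp_mulVec]
  refine (sum_smul_dotProduct_self_le Finset.univ (rBlkWt_nonneg n Ωc (fineDom n Ωc) y) _).trans ?_
  simp_rw [orth_dotProduct_mulVec_self (hT y _)]
  exact mul_le_mul_of_nonneg_right (sum_rBlkWt_row hn Ωc y)
    (Finset.sum_nonneg fun x _ => mul_nonneg (rBlkWt_nonneg n Ωc _ y x) (dotProduct_self_nonneg' _))

/-- `‖QΦ‖₂² ≤ n^{d+1}‖Φ‖₂²` (each fine point lies in one block). [folklore] -/
theorem avgOp_sq_le (hn : 1 ≤ n) (Ωc : Finset (Fin (d + 1) → ℤ))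
    (T : ↥Ωc → ↥(fineDom n Ωc) → Matrix ι ι ℝ) (hT : ∀ y x, (T y x)ᵀ * T y x = 1)
    (Φ : ↥(fineDom n Ωc) × ι → ℝ) :
    (avgOp (rBlkWt n Ωc (fineDom n Ωc)) T *ᵥ Φ) ⬝ᵥ (avgOp (rBlkWt n Ωc (fineDom n Ωc)) T *ᵥ Φ)
      ≤ (n : ℝ) ^ (d + 1) * (Φ ⬝ᵥ Φ) := by
  rw [dotProduct_eq_sum_fld (avgOp _ T *ᵥ Φ)]
  calc ∑ y, fld (avgOp (rBlkWt n Ωc (fineDom n Ωc)) T *ᵥ Φ) y ⬝ᵥ fld (avgOp (rBlkWt n Ωc (fineDom n Ωc)) T *ᵥ Φ) y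
      ≤ ∑ y, (n : ℝ) ^ (d + 1) * ∑ x, rBlkWt n Ωc (fineDom n Ωc) y x * (fld Φ x ⬝ᵥ fld Φ x) :=
        Finset.sum_le_sum fun y _ => fld_avgOp_sq_le hn Ωc T hT Φ y
    _ = (n : ℝ) ^ (d + 1) * ∑ x, (∑ y, rBlkWt n Ωc (fineDom n Ωc) y x) * (fld Φ x ⬝ᵥ fld Φ x) := by
        rw [← Finset.mul_sum, Finset.sum_comm]
        congr 1
        exact Finset.sum_congr rfl fun x _ => by rw [Finset.sum_mul]
    _ ≤ (n : ℝ) ^ (d + 1) * ∑ x, 1 * (fld Φ x ⬝ᵥ fld Φ x) := by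
        refine mul_le_mul_of_nonneg_left (Finset.sum_le_sum fun x _ => ?_) (by positivity)
        exact mul_le_mul_of_nonneg_right (sum_rBlkWt_col n Ωc _ x) (dotProduct_self_nonneg' _)
    _ = (n : ℝ) ^ (d + 1) * (Φ ⬝ᵥ Φ) := by simp_rw [one_mul]; rw [← dotProduct_eq_sum_fld]

omit [DecidableEq ι] in
/-- the localised version: `Σ_{y} |(QΦ)(y)|²·1[(Qw)(y) ≠ 0] ≤ n^{d+1} Σ_{x∈S'} |Φ(x)|²` when `w` vanishes off `S`
and `S'` contains every point sharing a block with a point of `S` — phrased as: `(Q(1_{S'}Φ))(y) = (QΦ)(y)`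
wherever `(Qw)(y) ≠ 0`. [folklore] -/
theorem fld_avgOp_eq_of_ne_zero (Ωc : Finset (Fin (d + 1) → ℤ)) (T : ↥Ωc → ↥(fineDom n Ωc) → Matrix ι ι ℝ)
    (Φ w : ↥(fineDom n Ωc) × ι → ℝ) (S S' : Finset ↥(fineDom n Ωc)) (hw : ∀ x, x ∉ S → fld w x = 0)
    (hS' : ∀ x x' : ↥(fineDom n Ωc), x' ∈ S → blk n x.1 = blk n x'.1 → x ∈ S') (y : ↥Ωc)
    (hy : fld (avgOp (rBlkWt n Ωc (fineDom n Ωc)) T *ᵥ w) y ≠ 0) :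
    fld (avgOp (rBlkWt n Ωc (fineDom n Ωc)) T *ᵥ (fun j => if j.1 ∈ S' then Φ j else 0)) y
      = fld (avgOp (rBlkWt n Ωc (fineDom n Ωc)) T *ᵥ Φ) y := by
  -- a point `x'` of `S` in the block `y`
  have hex : ∃ x' : ↥(fineDom n Ωc), x' ∈ S ∧ blk n x'.1 = y.1 := by
    by_contra hne
    apply hy
    rw [fld_avgOp_mulVec]
    refine Finset.sum_eq_zero fun x _ => ?_
    by_cases hq : rBlkWt n Ωc (fineDom n Ωc) y x = 0
    · rw [hq, zero_smul]
    · have hb := rBlkWt_ne_zero hq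
      have hx : x ∉ S := fun hx => hne ⟨x, hx, hb⟩
      rw [hw x hx, Matrix.mulVec_zero, smul_zero]
  obtain ⟨x', hx'S, hx'b⟩ := hex
  rw [fld_avgOp_mulVec, fld_avgOp_mulVec]
  refine Finset.sum_congr rfl fun x _ => ?_
  by_cases hq : rBlkWt n Ωc (fineDom n Ωc) y x = 0
  · rw [hq, zero_smul, zero_smul]
  · have hb := rBlkWt_ne_zero hq
    have hx : x ∈ S' := hS' x x' hx'S (hb.trans hx'b.symm)
    have hfld : fld (fun j : ↥(fineDom n Ωc) × ι => if j.1 ∈ S' then Φ j else 0) x = fld Φ x := by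
      funext i; simp only [fld_apply, if_pos hx]
    rw [hfld]

/-- **THE AVERAGING TERM, LOCALISED**: `|⟨v, Q^*Qw⟩| ≤ n^{d+1} (Σ_{x∈S'}|v(x)|²)^{1/2} ‖w‖₂` for `w` vanishing off `S`
and `S' ⊇` the blocks meeting `S`. [folklore] -/
theorem abs_dot_projOp_le (hn : 1 ≤ n) (Ωc : Finset (Fin (d + 1) → ℤ))
    (T : ↥Ωc → ↥(fineDom n Ωc) → Matrix ι ι ℝ) (hT : ∀ y x, (T y x)ᵀ * T y x = 1)
    (v w : ↥(fineDom n Ωc) × ι → ℝ) (S S' : Finset ↥(fineDom n Ωc)) (hw : ∀ x, x ∉ S → fld w x = 0)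
    (hS' : ∀ x x' : ↥(fineDom n Ωc), x' ∈ S → blk n x.1 = blk n x'.1 → x ∈ S') :
    |v ⬝ᵥ (projOp (rBlkWt n Ωc (fineDom n Ωc)) T *ᵥ w)|
      ≤ (n : ℝ) ^ (d + 1) * Real.sqrt (∑ x ∈ S', fld v x ⬝ᵥ fld v x) * Real.sqrt (w ⬝ᵥ w) := by
  obtain ⟨v', hv'⟩ : ∃ v' : ↥(fineDom n Ωc) × ι → ℝ, v' = fun j => if j.1 ∈ S' then v j else 0 := ⟨_, rfl⟩
  have hN : (0 : ℝ) ≤ (n : ℝ) ^ (d + 1) := by positivity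
  -- replace `v` by its localisation `v' = 1_{S'} v`
  have h1 : v ⬝ᵥ (projOp (rBlkWt n Ωc (fineDom n Ωc)) T *ᵥ w)
      = (avgOp (rBlkWt n Ωc (fineDom n Ωc)) T *ᵥ v') ⬝ᵥ (avgOp (rBlkWt n Ωc (fineDom n Ωc)) T *ᵥ w) := by
    rw [projOp_biform, dotProduct_eq_sum_fld (avgOp _ T *ᵥ v), dotProduct_eq_sum_fld (avgOp _ T *ᵥ v')]
    refine Finset.sum_congr rfl fun y _ => ?_
    by_cases hy : fld (avgOp (rBlkWt n Ωc (fineDom n Ωc)) T *ᵥ w) y = 0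
    · rw [hy, dotProduct_zero, dotProduct_zero]
    · rw [hv', fld_avgOp_eq_of_ne_zero Ωc T v w S S' hw hS' y hy]
  have hv'v' : v' ⬝ᵥ v' = ∑ x ∈ S', fld v x ⬝ᵥ fld v x := by
    rw [dotProduct_eq_sum_fld v' v', ← Finset.sum_subset (Finset.subset_univ S')]
    · refine Finset.sum_congr rfl fun x hx => ?_
      have hfld : fld v' x = fld v x := by
        funext i; rw [hv']; simp only [fld_apply, if_pos hx]
      rw [hfld]
    · intro x _ hx
      have hfld : fld v' x = 0 := by
        funext i; rw [hv']; simp only [fld_apply, if_neg hx, Pi.zero_apply]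
      rw [hfld, dotProduct_zero]
  rw [h1]
  calc |(avgOp (rBlkWt n Ωc (fineDom n Ωc)) T *ᵥ v') ⬝ᵥ (avgOp (rBlkWt n Ωc (fineDom n Ωc)) T *ᵥ w)|
      ≤ Real.sqrt ((avgOp (rBlkWt n Ωc (fineDom n Ωc)) T *ᵥ v') ⬝ᵥ (avgOp (rBlkWt n Ωc (fineDom n Ωc)) T *ᵥ v'))
          * Real.sqrt ((avgOp (rBlkWt n Ωc (fineDom n Ωc)) T *ᵥ w) ⬝ᵥ (avgOp (rBlkWt n Ωc (fineDom n Ωc)) T *ᵥ w)) :=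
        abs_dot_le_sqrt _ _
    _ ≤ Real.sqrt ((n : ℝ) ^ (d + 1) * (v' ⬝ᵥ v')) * Real.sqrt ((n : ℝ) ^ (d + 1) * (w ⬝ᵥ w)) :=
        mul_le_mul (Real.sqrt_le_sqrt (avgOp_sq_le hn Ωc T hT v')) (Real.sqrt_le_sqrt (avgOp_sq_le hn Ωc T hT w))
          (Real.sqrt_nonneg _) (Real.sqrt_nonneg _)
    _ = (n : ℝ) ^ (d + 1) * Real.sqrt (∑ x ∈ S', fld v x ⬝ᵥ fld v x) * Real.sqrt (w ⬝ᵥ w) := by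
        rw [Real.sqrt_mul hN, Real.sqrt_mul hN, hv'v']
        have hs : Real.sqrt ((n : ℝ) ^ (d + 1)) * Real.sqrt ((n : ℝ) ^ (d + 1)) = (n : ℝ) ^ (d + 1) :=
          Real.mul_self_sqrt hN
        calc Real.sqrt ((n : ℝ) ^ (d + 1)) * Real.sqrt (∑ x ∈ S', fld v x ⬝ᵥ fld v x)
              * (Real.sqrt ((n : ℝ) ^ (d + 1)) * Real.sqrt (w ⬝ᵥ w))
            = (Real.sqrt ((n : ℝ) ^ (d + 1)) * Real.sqrt ((n : ℝ) ^ (d + 1)))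
              * Real.sqrt (∑ x ∈ S', fld v x ⬝ᵥ fld v x) * Real.sqrt (w ⬝ᵥ w) := by ring
          _ = _ := by rw [hs]

end Proj

/-! ## §7  The two shapes of the test functions, the collar masses and their constants -/

section Masses

variable {d : ℕ} {ι : Type*} [Fintype ι] [DecidableEq ι] {n : ℕ} {R R₀ : Finset (Fin (d + 1) → ℤ)}
  {H : Matrix (↥R × ι) (↥R × ι) ℝ} {W : ↥R → ↥R → Matrix ι ι ℝ} {σ σ' δ : ℝ}

/-- **THE TWIST**: the test function `t` itself (`b = false`) or `D^{η*}_{W,ν}t` (`b = true`) — the two shapes in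
which `f` and `f'` enter the four pairings of Corollary 2.3 (`⟨f, D_μX⟩ = ⟨D_μ^*f, X⟩`).
[cite: Balaban1983RegularityDecay, p. 580 (2.30), dictionary] -/
def twV (n : ℕ) (R : Finset (Fin (d + 1) → ℤ)) (W : ↥R → ↥R → Matrix ι ι ℝ) (b : Bool) (ν : Fin (d + 1))
    (t : ↥R × ι → ℝ) : ↥R × ι → ℝ :=
  match b with
  | false => t
  | true => (covDeriv n R W ν)ᵀ *ᵥ t

/-- untwisted. [folklore] -/
@[simp] theorem twV_false (ν : Fin (d + 1)) (t : ↥R × ι → ℝ) : twV n R W false ν t = t := rfl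

/-- twisted. [folklore] -/
@[simp] theorem twV_true (ν : Fin (d + 1)) (t : ↥R × ι → ℝ) : twV n R W true ν t = (covDeriv n R W ν)ᵀ *ᵥ t := rfl

omit [DecidableEq ι] in
/-- **THE PRE-TEST FUNCTION ON `Ω` WHOSE EXTENSION IS THE TEST FUNCTION ON `Ω₀`**: `f` itself (`b = false`) or `f`
with the components just inside `∂Ω` facing `Ω₀∖Ω` switched off (`b = true`, `B4Cor23RegionDeltaAlg.offL`).
[folklore] -/
def ftw (R₀ : Finset (Fin (d + 1) → ℤ)) (b : Bool) (μ : Fin (d + 1)) (f : ↥R × ι → ℝ) : ↥R × ι → ℝ :=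
  match b with
  | false => f
  | true => offL R₀ μ f

omit [Fintype ι] [DecidableEq ι] in
/-- untwisted. [folklore] -/
@[simp] theorem ftw_false (μ : Fin (d + 1)) (f : ↥R × ι → ℝ) : ftw R₀ false μ f = f := rfl

omit [Fintype ι] [DecidableEq ι] in
/-- twisted. [folklore] -/
@[simp] theorem ftw_true (μ : Fin (d + 1)) (f : ↥R × ι → ℝ) : ftw R₀ true μ f = offL R₀ μ f := rfl

omit [DecidableEq ι] in
/-- `‖ftw f‖ ≤ ‖f‖`. [folklore] -/
theorem ftw_dot_self_le (b : Bool) (μ : Fin (d + 1)) (f : ↥R × ι → ℝ) :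
    ftw R₀ b μ f ⬝ᵥ ftw R₀ b μ f ≤ f ⬝ᵥ f := by
  cases b with
  | false => exact le_rfl
  | true => exact offL_dot_self_le μ f

omit [Fintype ι] [DecidableEq ι] in
/-- `ftw f` vanishes where `f` does. [folklore] -/
theorem ftw_eq_zero_of (b : Bool) (μ : Fin (d + 1)) (f : ↥R × ι → ℝ) (j : ↥R × ι) (h : f j = 0) :
    ftw R₀ b μ f j = 0 := by
  cases b with
  | false => exact h
  | true => exact offL_eq_zero_of μ f j h

omit [DecidableEq ι] in
/-- the extension of `ftw f` is supported in (the image of) `supp f`. [folklore] -/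
theorem extV_ftw_eq_zero (h : R ⊆ R₀) (b : Bool) (μ : Fin (d + 1)) (f : ↥R × ι → ℝ) (j : ↥R₀ × ι)
    (hj : j.1 ∉ (bsupp f).map (inclEmb h)) : extV R₀ (ftw R₀ b μ f) j = 0 := by
  by_cases hjR : j.1.1 ∈ R
  · rw [extV, dif_pos hjR]
    refine ftw_eq_zero_of b μ f _ (eq_zero_of_not_mem_bsupp f _ fun hmem => hj ?_)
    exact Finset.mem_map.2 ⟨_, hmem, Subtype.ext rfl⟩
  · exact extV_of_not_mem _ j hjR

omit [DecidableEq ι] in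
/-- `‖ext(ftw f)‖₂ ≤ ‖f‖₂`. [folklore] -/
theorem bl2n_extV_ftw_le (h : R ⊆ R₀) (b : Bool) (μ : Fin (d + 1)) (f : ↥R × ι → ℝ) :
    bl2n (extV R₀ (ftw R₀ b μ f)) ≤ bl2n f := by
  unfold bl2n
  rw [extV_dotProduct_extV h]
  exact Real.sqrt_le_sqrt (ftw_dot_self_le b μ f)

/-- **THE FOUR PAIRINGS OF THE MAIN CLAUSE, TWIST-INDEXED**: `|⟨f̃, H⁻¹ g̃⟩| ≤ c(σ)e^{−δρ}‖f‖₂‖g‖₂` for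
`f̃ ∈ {f, D_μ^*f}`, `g̃ ∈ {g, D_ν^*g}`, `f` supported in `S`, `g` in `T` at distance `≥ ρ`
(`B4Cor23Region.pairings_set`). [cite: Balaban1983RegularityDecay, p. 580 (2.30)] [cite: CombesThomas1973, §II] -/
theorem abs_twV_pair_le (h : CTHyp n R H W σ δ) (S T : Finset ↥R) (ρ : ℝ)
    (hρ : ∀ x ∈ S, ∀ t ∈ T, ρ ≤ edistR n R x t) (F G : ↥R × ι → ℝ) (hF : ∀ j, j.1 ∉ S → F j = 0)
    (hG : ∀ j, j.1 ∉ T → G j = 0) (b b' : Bool) (μ ν : Fin (d + 1)) :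
    |twV n R W b μ F ⬝ᵥ (H⁻¹ *ᵥ twV n R W b' ν G)| ≤ cR σ * Real.exp (-(δ * ρ)) * bl2n F * bl2n G := by
  obtain ⟨h1, h2, h3, h4⟩ := pairings_set h S T ρ hρ F G hF hG μ ν
  cases b <;> cases b' <;> simp only [twV_false, twV_true]
  · exact h1
  · exact h3
  · rw [← dot_mulVec_eq_transpose_dot]; exact h2
  · rw [← dot_mulVec_eq_transpose_dot]; exact h4

/-- THE COLLAR-MASS CONSTANT of the Green's function: `K₀(σ) = 8(1 + 4/σ)`. [folklore] -/
def K0 (σ : ℝ) : ℝ := 8 * (1 + 4 / σ)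

/-- THE COLLAR-MASS CONSTANT of the derivative of the Green's function: `K₁(σ) = 16(1 + 4/σ)²`. [folklore] -/
def K1 (σ : ℝ) : ℝ := 16 * (1 + 4 / σ) ^ 2

/-- `K₀ ≥ 0`. [folklore] -/
theorem K0_nonneg (hσ : 0 < σ) : 0 ≤ K0 σ := by unfold K0; positivity

/-- `K₁ ≥ 0`. [folklore] -/
theorem K1_nonneg (σ : ℝ) : 0 ≤ K1 σ := by unfold K1; positivity

/-- the four set-decay constants of `B4Cor23Region` §D with coercivity `σ' ≥ σ > 0` and rate `δ ≤ 1` are below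
`K₀(σ)/σ'` (Green's function) and `K₁(σ)` (its derivative). [folklore] -/
theorem consts_le' (hσ : 0 < σ) (hσσ : σ ≤ σ') (hδ0 : 0 ≤ δ) (hδ1 : δ ≤ 1) :
    (2 / σ') ^ 2 ≤ K0 σ / σ' ∧ 8 / σ' * (1 + 4 * δ ^ 2 / σ') ≤ K0 σ / σ'
      ∧ 8 / σ' * (1 + 4 * δ ^ 2 / σ') ≤ K1 σ ∧ 16 * (1 + 4 * δ ^ 2 / σ') ^ 2 ≤ K1 σ := by
  have hσ' : 0 < σ' := hσ.trans_le hσσ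
  have hu0 : 0 < σ'⁻¹ := inv_pos.2 hσ'
  have hw0 : 0 < σ⁻¹ := inv_pos.2 hσ
  have huw : σ'⁻¹ ≤ σ⁻¹ := by simpa only [one_div] using one_div_le_one_div_of_le hσ hσσ
  have hδ2 : δ ^ 2 ≤ 1 := by nlinarith
  have hδu : δ ^ 2 * σ'⁻¹ ≤ σ⁻¹ := by nlinarith
  have p1 := mul_le_mul_of_nonneg_left huw hu0.le
  have p2 := mul_le_mul_of_nonneg_left hδu hu0.le
  have p3 := mul_le_mul_of_nonneg_right huw hw0.le
  unfold K0 K1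
  simp only [div_eq_mul_inv]
  refine ⟨?_, ?_, ?_, ?_⟩
  · nlinarith
  · nlinarith
  · nlinarith
  · have h1 : 0 ≤ 1 + 4 * δ ^ 2 * σ'⁻¹ := by positivity
    have h2 : 1 + 4 * δ ^ 2 * σ'⁻¹ ≤ 1 + 4 * σ⁻¹ := by linarith
    have h3 := mul_le_mul h2 h2 h1 (by positivity)
    nlinarith

/-- **THE COLLAR MASS OF A GREEN'S FUNCTION COLUMN**: `Σ_{x∈S} |(H⁻¹ t̃)(x)|² ≤ (K₀(σ)/σ')·e^{−2δρ}‖t‖²` for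
`t̃ ∈ {t, D_ν^*t}`, `t` supported in `T` at distance `≥ ρ` from `S`, `H` coercive with constant `σ' ≥ σ`.
[cite: Balaban1983RegularityDecay, p. 580 (2.30)] [cite: CombesThomas1973, §II] -/
theorem mass0_le (h : CTHyp n R H W σ' δ) (hσ : 0 < σ) (hσσ : σ ≤ σ') (S T : Finset ↥R) (ρ : ℝ)
    (hρ : ∀ x ∈ S, ∀ t ∈ T, ρ ≤ edistR n R x t) (b : Bool) (ν : Fin (d + 1)) (t : ↥R × ι → ℝ)
    (ht : ∀ j, j.1 ∉ T → t j = 0) :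
    ∑ x ∈ S, fld (H⁻¹ *ᵥ twV n R W b ν t) x ⬝ᵥ fld (H⁻¹ *ᵥ twV n R W b ν t) x
      ≤ K0 σ / σ' * Real.exp (-(2 * (δ * ρ))) * (t ⬝ᵥ t) := by
  obtain ⟨c1, c2, -, -⟩ := consts_le' hσ hσσ h.nonneg h.le_one
  have hE : 0 ≤ Real.exp (-(2 * (δ * ρ))) * (t ⬝ᵥ t) := mul_nonneg (Real.exp_nonneg _) (dotProduct_self_nonneg' t)
  cases b with
  | false =>
    rw [twV_false]
    calc _ ≤ (2 / σ') ^ 2 * Real.exp (-(2 * (δ * ρ))) * (t ⬝ᵥ t) := green_setDecay h S T ρ hρ t ht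
      _ ≤ _ := by rw [mul_assoc, mul_assoc]; exact mul_le_mul_of_nonneg_right c1 hE
  | true =>
    rw [twV_true]
    calc _ ≤ 8 / σ' * (1 + 4 * δ ^ 2 / σ') * Real.exp (-(2 * (δ * ρ))) * (t ⬝ᵥ t) :=
          greenT_setDecay h S T ρ hρ ν t ht
      _ ≤ _ := by rw [mul_assoc, mul_assoc (K0 σ / σ')]; exact mul_le_mul_of_nonneg_right c2 hE

/-- **THE COLLAR MASS OF THE DERIVATIVE OF A GREEN'S FUNCTION COLUMN**:
`Σ_{x∈S} |(D_μH⁻¹ t̃)(x)|² ≤ K₁(σ)·e^{−2δρ}‖t‖²`. [cite: Balaban1983RegularityDecay, p. 580 (2.30)]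
[cite: CombesThomas1973, §II] -/
theorem mass1_le (h : CTHyp n R H W σ' δ) (hσ : 0 < σ) (hσσ : σ ≤ σ') (S T : Finset ↥R) (ρ : ℝ)
    (hρ : ∀ x ∈ S, ∀ t ∈ T, ρ ≤ edistR n R x t) (b : Bool) (ν : Fin (d + 1)) (t : ↥R × ι → ℝ)
    (ht : ∀ j, j.1 ∉ T → t j = 0) (μ : Fin (d + 1)) :
    ∑ x ∈ S, fld (covDeriv n R W μ *ᵥ (H⁻¹ *ᵥ twV n R W b ν t)) x
        ⬝ᵥ fld (covDeriv n R W μ *ᵥ (H⁻¹ *ᵥ twV n R W b ν t)) x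
      ≤ K1 σ * Real.exp (-(2 * (δ * ρ))) * (t ⬝ᵥ t) := by
  obtain ⟨-, -, c3, c4⟩ := consts_le' hσ hσσ h.nonneg h.le_one
  have hE : 0 ≤ Real.exp (-(2 * (δ * ρ))) * (t ⬝ᵥ t) := mul_nonneg (Real.exp_nonneg _) (dotProduct_self_nonneg' t)
  cases b with
  | false =>
    rw [twV_false]
    calc _ ≤ 8 / σ' * (1 + 4 * δ ^ 2 / σ') * Real.exp (-(2 * (δ * ρ))) * (t ⬝ᵥ t) :=
          dgreen_setDecay h S T ρ hρ t ht μ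
      _ ≤ _ := by rw [mul_assoc, mul_assoc (K1 σ)]; exact mul_le_mul_of_nonneg_right c3 hE
  | true =>
    rw [twV_true]
    calc _ ≤ 16 * (1 + 4 * δ ^ 2 / σ') ^ 2 * Real.exp (-(2 * (δ * ρ))) * (t ⬝ᵥ t) :=
          dgreenT_setDecay h S T ρ hρ μ ν t ht
      _ ≤ _ := by rw [mul_assoc, mul_assoc (K1 σ)]; exact mul_le_mul_of_nonneg_right c4 hE

/-- `e^{−2δρ}‖t‖² ≤ (e^{−δρ}‖f‖₂)²` when `‖t‖ ≤ ‖f‖`. [folklore] -/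
theorem exp_mul_le_sq {J J' : Type*} [Fintype J] [Fintype J'] {t : J → ℝ} {f : J' → ℝ} (htf : t ⬝ᵥ t ≤ f ⬝ᵥ f)
    (δ ρ : ℝ) : Real.exp (-(2 * (δ * ρ))) * (t ⬝ᵥ t) ≤ (Real.exp (-(δ * ρ)) * bl2n f) ^ 2 := by
  have h1 : Real.exp (-(2 * (δ * ρ))) = Real.exp (-(δ * ρ)) ^ 2 := by
    rw [sq, ← Real.exp_add]; congr 1; ring
  rw [mul_pow, bl2n, Real.sq_sqrt (dotProduct_self_nonneg' f), h1]
  exact mul_le_mul_of_nonneg_left htf (sq_nonneg _)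

end Masses

/-! ## §8  The two terms of the cutoff representation for [B4]'s nested regions -/

section Region

variable {d : ℕ} {ι : Type*} [Fintype ι] [DecidableEq ι]

variable (F : OrthFlow ι) (e : ℝ) {n : ℕ} (hn : 1 ≤ n) (a m2 : ℝ) {Ωc Ω₀c : Finset (Fin (d + 1) → ℤ)}
  (hΩ : Ωc ⊆ Ω₀c) (Ac : (Fin (d + 1) → ℤ) → Fin (d + 1) → ℝ)

/-- `D^η_{A,μ}` on the region is the covariant derivative with [B4]'s link variables (definitional). [folklore] -/
theorem regionDeriv_eq_covDeriv (Ωc : Finset (Fin (d + 1) → ℤ)) (μ : Fin (d + 1)) :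
    regionDeriv F e n Ωc Ac μ = covDeriv n (fineDom n Ωc) (lnk F e n Ωc Ac) μ := rfl

include hn hΩ in
/-- **EXTENDING A TWISTED TEST FUNCTION**: `ext f = ext f` and `ext(D^{η,Ω*}_{A,μ}f) = D^{η,Ω₀*}_{A,μ} ext(offL f)`
(the vector form of `B4Cor23RegionDeltaAlg.dot_extV_regionDeriv_transpose`). [folklore] -/
theorem extV_twV (b : Bool) (μ : Fin (d + 1)) (f : ↥(fineDom n Ωc) × ι → ℝ) :
    extV (fineDom n Ω₀c) (twV n (fineDom n Ωc) (lnk F e n Ωc Ac) b μ f)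
      = twV n (fineDom n Ω₀c) (lnk F e n Ω₀c Ac) b μ (extV (fineDom n Ω₀c) (ftw (fineDom n Ω₀c) b μ f)) := by
  cases b with
  | false => rfl
  | true =>
    rw [twV_true, twV_true, ftw_true]
    funext j
    have h := dot_extV_covDeriv_transpose n (fineDom_mono hn hΩ) (lnk F e n Ω₀c Ac) (lnk F e n Ωc Ac)
      (fun _ _ => rfl) μ (Pi.single j 1) f
    rwa [single_dotProduct, single_dotProduct, one_mul, one_mul] at h

/-- **THE `f`-SIDE COLLAR MASSES**: for `v = (G_k(Ω₀,A) ext f̃)|_Ω`, `Σ_{S_4}|v|² ≤ (K₀/σ')(e^{−δ(ρ_f−4)}‖f‖₂)²` and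
`Σ_{S_4}|D^η_{A,μ'}v|² ≤ K₁(e^{−δ(ρ_f−4)}‖f‖₂)²`, `ρ_f = dist_η(supp f, Ω₀∖Ω)`.
[cite: Balaban1983RegularityDecay, p. 581 Corollary 2.3 (δG clause)] [cite: CombesThomas1973, §II] -/
theorem fside_masses (hout : (outR (fineDom n Ωc) (fineDom n Ω₀c)).Nonempty) {σ σ' δ : ℝ}
    (hM₀ : CTHyp n (fineDom n Ω₀c) (regionOp F e hn a m2 Ω₀c Ac) (lnk F e n Ω₀c Ac) σ' δ) (hσ : 0 < σ)
    (hσσ : σ ≤ σ') (b : Bool) (μ : Fin (d + 1)) (f : ↥(fineDom n Ωc) × ι → ℝ) :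
    (∑ x ∈ lev n (fineDom_mono hn hΩ) hout 4,
        fld (resV (fineDom_mono hn hΩ) ((regionOp F e hn a m2 Ω₀c Ac)⁻¹ *ᵥ
          twV n (fineDom n Ω₀c) (lnk F e n Ω₀c Ac) b μ (extV (fineDom n Ω₀c) (ftw (fineDom n Ω₀c) b μ f)))) x
        ⬝ᵥ fld (resV (fineDom_mono hn hΩ) ((regionOp F e hn a m2 Ω₀c Ac)⁻¹ *ᵥ
          twV n (fineDom n Ω₀c) (lnk F e n Ω₀c Ac) b μ (extV (fineDom n Ω₀c) (ftw (fineDom n Ω₀c) b μ f)))) x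
      ≤ K0 σ / σ' * (Real.exp (-(δ * (bdistV n (fineDom_mono hn hΩ) f - 4))) * bl2n f) ^ 2)
    ∧ ∀ μ' : Fin (d + 1), ∑ x ∈ lev n (fineDom_mono hn hΩ) hout 4,
        fld (regionDeriv F e n Ωc Ac μ' *ᵥ resV (fineDom_mono hn hΩ) ((regionOp F e hn a m2 Ω₀c Ac)⁻¹ *ᵥ
          twV n (fineDom n Ω₀c) (lnk F e n Ω₀c Ac) b μ (extV (fineDom n Ω₀c) (ftw (fineDom n Ω₀c) b μ f)))) x
        ⬝ᵥ fld (regionDeriv F e n Ωc Ac μ' *ᵥ resV (fineDom_mono hn hΩ) ((regionOp F e hn a m2 Ω₀c Ac)⁻¹ *ᵥ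
          twV n (fineDom n Ω₀c) (lnk F e n Ω₀c Ac) b μ (extV (fineDom n Ω₀c) (ftw (fineDom n Ω₀c) b μ f)))) x
      ≤ K1 σ * (Real.exp (-(δ * (bdistV n (fineDom_mono hn hΩ) f - 4))) * bl2n f) ^ 2 := by
  have ht : ∀ j : ↥(fineDom n Ω₀c) × ι, j.1 ∉ (bsupp f).map (inclEmb (fineDom_mono hn hΩ)) →
      extV (fineDom n Ω₀c) (ftw (fineDom n Ω₀c) b μ f) j = 0 := extV_ftw_eq_zero _ b μ f
  have hρ : ∀ z ∈ (lev n (fineDom_mono hn hΩ) hout 4).map (inclEmb (fineDom_mono hn hΩ)),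
      ∀ w ∈ (bsupp f).map (inclEmb (fineDom_mono hn hΩ)),
        bdistV n (fineDom_mono hn hΩ) f - 4 ≤ edistR n (fineDom n Ω₀c) z w := by
    intro z hz w hw
    rw [Finset.mem_map] at hz hw
    obtain ⟨x, hx, rfl⟩ := hz
    obtain ⟨s, hs, rfl⟩ := hw
    show _ ≤ edistR n (fineDom n Ω₀c) (incl (fineDom_mono hn hΩ) x) (incl (fineDom_mono hn hΩ) s)
    rw [edistR_incl]
    exact le_edistR_of_mem_lev hx f hs
  have htt : extV (fineDom n Ω₀c) (ftw (fineDom n Ω₀c) b μ f) ⬝ᵥ extV (fineDom n Ω₀c) (ftw (fineDom n Ω₀c) b μ f)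
      ≤ f ⬝ᵥ f := by
    rw [extV_dotProduct_extV (fineDom_mono hn hΩ)]; exact ftw_dot_self_le b μ f
  have hX := exp_mul_le_sq htt δ (bdistV n (fineDom_mono hn hΩ) f - 4)
  have m0 := mass0_le hM₀ hσ hσσ _ _ _ hρ b μ _ ht
  have m1 := fun μ' => mass1_le hM₀ hσ hσσ _ _ _ hρ b μ _ ht μ'
  have hK0 : 0 ≤ K0 σ / σ' := div_nonneg (K0_nonneg hσ) (hσ.trans_le hσσ).le
  constructor
  · calc _ = ∑ z ∈ (lev n (fineDom_mono hn hΩ) hout 4).map (inclEmb (fineDom_mono hn hΩ)),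
          fld ((regionOp F e hn a m2 Ω₀c Ac)⁻¹ *ᵥ twV n (fineDom n Ω₀c) (lnk F e n Ω₀c Ac) b μ
              (extV (fineDom n Ω₀c) (ftw (fineDom n Ω₀c) b μ f))) z
            ⬝ᵥ fld ((regionOp F e hn a m2 Ω₀c Ac)⁻¹ *ᵥ twV n (fineDom n Ω₀c) (lnk F e n Ω₀c Ac) b μ
              (extV (fineDom n Ω₀c) (ftw (fineDom n Ω₀c) b μ f))) z := by
          rw [Finset.sum_map]; rfl
      _ ≤ _ := m0
      _ ≤ _ := by rw [mul_assoc]; exact mul_le_mul_of_nonneg_left hX hK0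
  · intro μ'
    calc _ ≤ ∑ x ∈ lev n (fineDom_mono hn hΩ) hout 4,
          fld (regionDeriv F e n Ω₀c Ac μ' *ᵥ ((regionOp F e hn a m2 Ω₀c Ac)⁻¹ *ᵥ
              twV n (fineDom n Ω₀c) (lnk F e n Ω₀c Ac) b μ (extV (fineDom n Ω₀c) (ftw (fineDom n Ω₀c) b μ f))))
              (incl (fineDom_mono hn hΩ) x)
            ⬝ᵥ fld (regionDeriv F e n Ω₀c Ac μ' *ᵥ ((regionOp F e hn a m2 Ω₀c Ac)⁻¹ *ᵥ
              twV n (fineDom n Ω₀c) (lnk F e n Ω₀c Ac) b μ (extV (fineDom n Ω₀c) (ftw (fineDom n Ω₀c) b μ f))))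
              (incl (fineDom_mono hn hΩ) x) :=
          Finset.sum_le_sum fun x _ => fld_regionDeriv_resV_sq_le F e hn hΩ Ac μ' _ x
      _ = ∑ z ∈ (lev n (fineDom_mono hn hΩ) hout 4).map (inclEmb (fineDom_mono hn hΩ)),
          fld (regionDeriv F e n Ω₀c Ac μ' *ᵥ ((regionOp F e hn a m2 Ω₀c Ac)⁻¹ *ᵥ
              twV n (fineDom n Ω₀c) (lnk F e n Ω₀c Ac) b μ (extV (fineDom n Ω₀c) (ftw (fineDom n Ω₀c) b μ f)))) z
            ⬝ᵥ fld (regionDeriv F e n Ω₀c Ac μ' *ᵥ ((regionOp F e hn a m2 Ω₀c Ac)⁻¹ *ᵥ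
              twV n (fineDom n Ω₀c) (lnk F e n Ω₀c Ac) b μ (extV (fineDom n Ω₀c) (ftw (fineDom n Ω₀c) b μ f)))) z := by
          rw [Finset.sum_map]; rfl
      _ ≤ _ := m1 μ'
      _ ≤ _ := by rw [mul_assoc]; exact mul_le_mul_of_nonneg_left hX (K1_nonneg σ)

/-- **THE `f'`-SIDE COLLAR MASSES**: for `u = G_k(Ω,A)g̃`, `Σ_{S_4}|u|² ≤ (K₀/σ')(e^{−δ(ρ_g−4)}‖g‖₂)²` and
`Σ_{S_4}|D^η_{A,μ'}u|² ≤ K₁(e^{−δ(ρ_g−4)}‖g‖₂)²`, `ρ_g = dist_η(supp g, Ω₀∖Ω)`.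
[cite: Balaban1983RegularityDecay, p. 581 Corollary 2.3 (δG clause)] [cite: CombesThomas1973, §II] -/
theorem gside_masses (hout : (outR (fineDom n Ωc) (fineDom n Ω₀c)).Nonempty) {σ σ' δ : ℝ}
    (hM : CTHyp n (fineDom n Ωc) (regionOp F e hn a m2 Ωc Ac) (lnk F e n Ωc Ac) σ' δ) (hσ : 0 < σ)
    (hσσ : σ ≤ σ') (b : Bool) (ν : Fin (d + 1)) (g : ↥(fineDom n Ωc) × ι → ℝ) :
    (∑ x ∈ lev n (fineDom_mono hn hΩ) hout 4,
        fld ((regionOp F e hn a m2 Ωc Ac)⁻¹ *ᵥ twV n (fineDom n Ωc) (lnk F e n Ωc Ac) b ν g) x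
        ⬝ᵥ fld ((regionOp F e hn a m2 Ωc Ac)⁻¹ *ᵥ twV n (fineDom n Ωc) (lnk F e n Ωc Ac) b ν g) x
      ≤ K0 σ / σ' * (Real.exp (-(δ * (bdistV n (fineDom_mono hn hΩ) g - 4))) * bl2n g) ^ 2)
    ∧ ∀ μ' : Fin (d + 1), ∑ x ∈ lev n (fineDom_mono hn hΩ) hout 4,
        fld (regionDeriv F e n Ωc Ac μ' *ᵥ
          ((regionOp F e hn a m2 Ωc Ac)⁻¹ *ᵥ twV n (fineDom n Ωc) (lnk F e n Ωc Ac) b ν g)) x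
        ⬝ᵥ fld (regionDeriv F e n Ωc Ac μ' *ᵥ
          ((regionOp F e hn a m2 Ωc Ac)⁻¹ *ᵥ twV n (fineDom n Ωc) (lnk F e n Ωc Ac) b ν g)) x
      ≤ K1 σ * (Real.exp (-(δ * (bdistV n (fineDom_mono hn hΩ) g - 4))) * bl2n g) ^ 2 := by
  have ht : ∀ j : ↥(fineDom n Ωc) × ι, j.1 ∉ bsupp g → g j = 0 := eq_zero_of_not_mem_bsupp g
  have hρ : ∀ x ∈ lev n (fineDom_mono hn hΩ) hout 4, ∀ t ∈ bsupp g,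
      bdistV n (fineDom_mono hn hΩ) g - 4 ≤ edistR n (fineDom n Ωc) x t :=
    fun x hx t htg => le_edistR_of_mem_lev hx g htg
  have hX := exp_mul_le_sq (le_refl (g ⬝ᵥ g)) δ (bdistV n (fineDom_mono hn hΩ) g - 4)
  have hK0 : 0 ≤ K0 σ / σ' := div_nonneg (K0_nonneg hσ) (hσ.trans_le hσσ).le
  refine ⟨(mass0_le hM hσ hσσ _ _ _ hρ b ν g ht).trans ?_, fun μ' => (mass1_le hM hσ hσσ _ _ _ hρ b ν g ht μ').trans ?_⟩
  · rw [mul_assoc]; exact mul_le_mul_of_nonneg_left hX hK0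
  · rw [mul_assoc]; exact mul_le_mul_of_nonneg_left hX (K1_nonneg σ)

/-- **THE FIRST TERM OF THE CUTOFF REPRESENTATION**: `|⟨f̃, θ·G_k(Ω,A)g̃⟩| ≤ 2c₀e^{−δρ₁}‖f‖₂‖g‖₂` whenever
`ρ₁ ≤ dist_η(x,t)` for all `x ∈ supp f ∩ S_4`, `t ∈ supp g` — by the Leibniz rule, the pieces `θ(·+ηe_μ)f`,
`η^{-1}(δ_μθ)f` (resp. `θf`) are test functions of norm `≤ ‖f‖₂` supported in `supp f ∩ S_4`, to which the main clause
applies. [cite: Balaban1983RegularityDecay, p. 581 Corollary 2.3 (δG clause)] [cite: CombesThomas1973, §II] -/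
theorem abs_T1_le (hout : (outR (fineDom n Ωc) (fineDom n Ω₀c)).Nonempty) {σ δ : ℝ}
    (hI : CTHyp n (fineDom n Ωc) (regionOp F e hn a m2 Ωc Ac) (lnk F e n Ωc Ac) σ δ)
    (f g : ↥(fineDom n Ωc) × ι → ℝ) (b b' : Bool) (μ ν : Fin (d + 1)) (ρ₁ : ℝ)
    (hρ₁ : ∀ x ∈ bsupp f, x ∈ lev n (fineDom_mono hn hΩ) hout 4 →
      ∀ t ∈ bsupp g, ρ₁ ≤ edistR n (fineDom n Ωc) x t) :
    |twV n (fineDom n Ωc) (lnk F e n Ωc Ac) b μ f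
        ⬝ᵥ smulF (thF n (fineDom_mono hn hΩ) hout)
          ((regionOp F e hn a m2 Ωc Ac)⁻¹ *ᵥ twV n (fineDom n Ωc) (lnk F e n Ωc Ac) b' ν g)|
      ≤ 2 * (cR σ * Real.exp (-(δ * ρ₁)) * bl2n f * bl2n g) := by
  -- a generic piece `ζf` with `|ζ| ≤ 1` and `supp f ∩ {ζ ≠ 0} ⊆ S_4`
  have piece : ∀ ζ : ↥(fineDom n Ωc) → ℝ, (∀ x, |ζ x| ≤ 1) →
      (∀ x ∈ bsupp f, ζ x ≠ 0 → x ∈ lev n (fineDom_mono hn hΩ) hout 4) → ∀ bb : Bool,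
      |twV n (fineDom n Ωc) (lnk F e n Ωc Ac) bb μ (smulF ζ f)
          ⬝ᵥ ((regionOp F e hn a m2 Ωc Ac)⁻¹ *ᵥ twV n (fineDom n Ωc) (lnk F e n Ωc Ac) b' ν g)|
        ≤ cR σ * Real.exp (-(δ * ρ₁)) * bl2n f * bl2n g := by
    intro ζ hζ1 hζL bb
    have hS : ∀ j : ↥(fineDom n Ωc) × ι, j.1 ∉ bsupp (smulF ζ f) → smulF ζ f j = 0 :=
      eq_zero_of_not_mem_bsupp _
    have hT : ∀ j : ↥(fineDom n Ωc) × ι, j.1 ∉ bsupp g → g j = 0 := eq_zero_of_not_mem_bsupp g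
    have hρ : ∀ x ∈ bsupp (smulF ζ f), ∀ t ∈ bsupp g, ρ₁ ≤ edistR n (fineDom n Ωc) x t :=
      fun x hx t htg => (mem_bsupp_smulF hx).elim fun hxf hζ => hρ₁ x hxf (hζL x hxf hζ) t htg
    refine (abs_twV_pair_le hI _ _ ρ₁ hρ (smulF ζ f) g hS hT bb b' μ ν).trans ?_
    have hE : 0 ≤ cR σ * Real.exp (-(δ * ρ₁)) := mul_nonneg (cR_pos hI.pos).le (Real.exp_nonneg _)
    exact mul_le_mul_of_nonneg_right (mul_le_mul_of_nonneg_left (bl2n_smulF_le ζ hζ1 f) hE) (Real.sqrt_nonneg _)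
  have hN : 0 ≤ cR σ * Real.exp (-(δ * ρ₁)) * bl2n f * bl2n g :=
    mul_nonneg (mul_nonneg (mul_nonneg (cR_pos hI.pos).le (Real.exp_nonneg _)) (Real.sqrt_nonneg _))
      (Real.sqrt_nonneg _)
  have hθ1 : ∀ x, |thF n (fineDom_mono hn hΩ) hout x| ≤ 1 := abs_thF_le_one (fineDom_mono hn hΩ) hout
  have h34 : lev n (fineDom_mono hn hΩ) hout (3 + 1) ⊆ lev n (fineDom_mono hn hΩ) hout 4 := lev_mono (fineDom_mono hn hΩ) hout (by norm_num)
  have h3 : lev n (fineDom_mono hn hΩ) hout 3 ⊆ lev n (fineDom_mono hn hΩ) hout 4 := lev_mono (fineDom_mono hn hΩ) hout (by norm_num)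
  cases b with
  | false =>
    rw [twV_false, dot_smulF]
    have h := piece (thF n (fineDom_mono hn hΩ) hout) hθ1
      (fun x _ hθ => h3 (mem_lev_of_thF_ne_zero hn (fineDom_mono hn hΩ) hout hθ)) false
    rw [twV_false] at h
    linarith
  | true =>
    rw [twV_true, ← dot_mulVec_eq_transpose_dot, dot_covDeriv_smulF]
    -- supports of the two Leibniz pieces
    have hsh : ∀ x ∈ bsupp f, shF μ (thF n (fineDom_mono hn hΩ) hout) x ≠ 0 → x ∈ lev n (fineDom_mono hn hΩ) hout 4 := by
      intro x _ hx
      unfold shF at hx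
      split_ifs at hx with hm
      · exact h34 (mem_lev_of_edistR_le (mem_lev_of_thF_ne_zero hn (fineDom_mono hn hΩ) hout hx)
          (by rw [edistR_comm]; exact edistR_fwd_le_one hn μ x hm))
      · exact absurd rfl hx
    have hjp : ∀ x ∈ bsupp f, jmpF n μ (thF n (fineDom_mono hn hΩ) hout) x ≠ 0 → x ∈ lev n (fineDom_mono hn hΩ) hout 4 := by
      intro x _ hx
      unfold jmpF at hx
      split_ifs at hx with hm
      · have hne : thF n (fineDom_mono hn hΩ) hout x ≠ thF n (fineDom_mono hn hΩ) hout ⟨x.1 + e1 μ, hm⟩ := by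
          intro heq; apply hx; rw [heq, sub_self, mul_zero]
        exact h3 (mem_lev_of_thF_jump hn (fineDom_mono hn hΩ) hout (edistR_fwd_le_one hn μ x hm) hne)
      · exact absurd rfl hx
    have h1 := piece (shF μ (thF n (fineDom_mono hn hΩ) hout)) (abs_shF_le_one μ hθ1) hsh true
    have h2 := piece (jmpF n μ (thF n (fineDom_mono hn hΩ) hout)) (abs_jmpF_le_one hn μ (abs_thF_sub_le (fineDom_mono hn hΩ) hout)) hjp false
    rw [twV_true, ← dot_mulVec_eq_transpose_dot] at h1
    rw [twV_false] at h2
    refine (abs_add_le _ _).trans ?_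
    linarith

/-- **THE SECOND TERM OF THE CUTOFF REPRESENTATION, BY FORMS ON THE COLLAR**: expanding
`H_k(Ω,A) = Σ_μ D_μ^*D_μ + m² + a_kQ^*Q` and using that `θu`, `D_μ(θu)` live on `S_4` (Leibniz),
`|⟨v, H_k(Ω,A)(θu)⟩| ≤ (d+1)(Σ_{S_4}|D v|²)^{1/2}(2Σ_{S_4}(|Du|² + |u|²))^{1/2} + (m² + a)(Σ_{S_4}|v|²)^{1/2}(Σ_{S_4}|u|²)^{1/2}`
(`a_k n^{d+1} = a`: each block average sees at most `n^{d+1}` points).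
[cite: Balaban1983RegularityDecay, p. 572 (1.3)–(1.6); p. 581 Corollary 2.3 (δG clause)] [folklore] -/
theorem abs_dot_regionOp_smulF_le (ha : 0 ≤ a) (hm : 0 ≤ m2)
    (hout : (outR (fineDom n Ωc) (fineDom n Ω₀c)).Nonempty) (V U : ↥(fineDom n Ωc) × ι → ℝ)
    {A₀ A₁ B₀ B₁ : ℝ}
    (hA0 : ∑ x ∈ lev n (fineDom_mono hn hΩ) hout 4, fld V x ⬝ᵥ fld V x ≤ A₀)
    (hA1 : ∀ μ, ∑ x ∈ lev n (fineDom_mono hn hΩ) hout 4,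
      fld (regionDeriv F e n Ωc Ac μ *ᵥ V) x ⬝ᵥ fld (regionDeriv F e n Ωc Ac μ *ᵥ V) x ≤ A₁)
    (hB0 : ∑ x ∈ lev n (fineDom_mono hn hΩ) hout 4, fld U x ⬝ᵥ fld U x ≤ B₀)
    (hB1 : ∀ μ, ∑ x ∈ lev n (fineDom_mono hn hΩ) hout 4,
      fld (regionDeriv F e n Ωc Ac μ *ᵥ U) x ⬝ᵥ fld (regionDeriv F e n Ωc Ac μ *ᵥ U) x ≤ B₁) :
    |V ⬝ᵥ (regionOp F e hn a m2 Ωc Ac *ᵥ smulF (thF n (fineDom_mono hn hΩ) hout) U)|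
      ≤ ((d : ℝ) + 1) * Real.sqrt A₁ * Real.sqrt (2 * (B₁ + B₀)) + (m2 + a) * Real.sqrt A₀ * Real.sqrt B₀ := by
  have hn0 : (0 : ℝ) < n := by exact_mod_cast hn
  have hNd : (0 : ℝ) < (n : ℝ) ^ (d + 1) := by positivity
  have hθ1 : ∀ x, |thF n (fineDom_mono hn hΩ) hout x| ≤ 1 := abs_thF_le_one (fineDom_mono hn hΩ) hout
  have hj1 : ∀ μ x, |jmpF n μ (thF n (fineDom_mono hn hΩ) hout) x| ≤ 1 := fun μ => abs_jmpF_le_one hn μ (abs_thF_sub_le (fineDom_mono hn hΩ) hout)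
  have h3 : lev n (fineDom_mono hn hΩ) hout 3 ⊆ lev n (fineDom_mono hn hΩ) hout 4 := lev_mono (fineDom_mono hn hΩ) hout (by norm_num)
  have h34 : lev n (fineDom_mono hn hΩ) hout (3 + 1) ⊆ lev n (fineDom_mono hn hΩ) hout 4 := lev_mono (fineDom_mono hn hΩ) hout (by norm_num)
  have hθ0 : ∀ x, x ∉ lev n (fineDom_mono hn hΩ) hout 3 → thF n (fineDom_mono hn hΩ) hout x = 0 := by
    intro x hx; by_contra h0; exact hx (mem_lev_of_thF_ne_zero hn (fineDom_mono hn hΩ) hout h0)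
  have hθ0' : ∀ x, x ∉ lev n (fineDom_mono hn hΩ) hout 4 → thF n (fineDom_mono hn hΩ) hout x = 0 := fun x hx => hθ0 x fun h => hx (h3 h)
  have hA0n : 0 ≤ A₀ := le_trans (Finset.sum_nonneg fun x _ => dotProduct_self_nonneg' _) hA0
  have hB0n : 0 ≤ B₀ := le_trans (Finset.sum_nonneg fun x _ => dotProduct_self_nonneg' _) hB0
  have hA1' : ∀ μ, ∑ x ∈ lev n (fineDom_mono hn hΩ) hout 4, fld (covDeriv n _ (lnk F e n Ωc Ac) μ *ᵥ V) x
      ⬝ᵥ fld (covDeriv n _ (lnk F e n Ωc Ac) μ *ᵥ V) x ≤ A₁ := hA1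
  have hB1' : ∀ μ, ∑ x ∈ lev n (fineDom_mono hn hΩ) hout 4, fld (covDeriv n _ (lnk F e n Ωc Ac) μ *ᵥ U) x
      ⬝ᵥ fld (covDeriv n _ (lnk F e n Ωc Ac) μ *ᵥ U) x ≤ B₁ := hB1
  -- `Σ_{S_4} |θU|² ≤ B₀` and `‖θU‖² ≤ B₀`
  have hθU : ∀ x, fld (smulF (thF n (fineDom_mono hn hΩ) hout) U) x ⬝ᵥ fld (smulF (thF n (fineDom_mono hn hΩ) hout) U) x ≤ fld U x ⬝ᵥ fld U x := by
    intro x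
    rw [fld_smulF, smul_dotProduct, dotProduct_smul, smul_eq_mul, smul_eq_mul]
    have := abs_le.1 (hθ1 x)
    have hsq : thF n (fineDom_mono hn hΩ) hout x * thF n (fineDom_mono hn hΩ) hout x ≤ 1 := by nlinarith
    have hU := dotProduct_self_nonneg' (fld U x)
    nlinarith
  have hvanU : ∀ x, x ∉ lev n (fineDom_mono hn hΩ) hout 4 → fld (smulF (thF n (fineDom_mono hn hΩ) hout) U) x = 0 := fun x hx => by
    rw [fld_smulF, hθ0' x hx, zero_smul]
  have hθU' : smulF (thF n (fineDom_mono hn hΩ) hout) U ⬝ᵥ smulF (thF n (fineDom_mono hn hΩ) hout) U ≤ B₀ := by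
    rw [dot_eq_sum_of_vanish _ _ _ hvanU]
    exact (Finset.sum_le_sum fun x _ => hθU x).trans hB0
  -- the decomposition of `H`
  have hdec : V ⬝ᵥ (regionOp F e hn a m2 Ωc Ac *ᵥ smulF (thF n (fineDom_mono hn hΩ) hout) U)
      = V ⬝ᵥ (covLap (regWt n (fineDom n Ωc)) (lnk F e n Ωc Ac) *ᵥ smulF (thF n (fineDom_mono hn hΩ) hout) U)
        + m2 * (V ⬝ᵥ smulF (thF n (fineDom_mono hn hΩ) hout) U)
        + a * ((n : ℝ) ^ (d + 1))⁻¹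
          * (V ⬝ᵥ (projOp (rBlkWt n Ωc (fineDom n Ωc)) (trn F e hn Ωc Ac) *ᵥ smulF (thF n (fineDom_mono hn hΩ) hout) U)) := by
    rw [regionOp_eq, Matrix.add_mulVec, Matrix.add_mulVec, Matrix.smul_mulVec, Matrix.smul_mulVec,
      Matrix.one_mulVec, dotProduct_add, dotProduct_add, dotProduct_smul, dotProduct_smul, smul_eq_mul, smul_eq_mul]
  -- (1) the Laplacian
  have hT : ∀ x y : ↥(fineDom n Ωc), y.1 ∈ nbrs x.1 → lnk F e n Ωc Ac y x = (lnk F e n Ωc Ac x y)ᵀ :=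
    fun x y _ => fieldLink_rev F (e / n) (compField_rev Ac x.1 y.1)
  have hO : ∀ x y : ↥(fineDom n Ωc), (lnk F e n Ωc Ac x y)ᵀ * lnk F e n Ωc Ac x y = 1 := fun x y => F.orth _
  have h1 : |V ⬝ᵥ (covLap (regWt n (fineDom n Ωc)) (lnk F e n Ωc Ac) *ᵥ smulF (thF n (fineDom_mono hn hΩ) hout) U)|
      ≤ ((d : ℝ) + 1) * Real.sqrt A₁ * Real.sqrt (2 * (B₁ + B₀)) := by
    rw [covLap_biform_eq_sum n _ hT hO]
    have hμ : ∀ μ, |(covDeriv n _ (lnk F e n Ωc Ac) μ *ᵥ V)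
        ⬝ᵥ (covDeriv n _ (lnk F e n Ωc Ac) μ *ᵥ smulF (thF n (fineDom_mono hn hΩ) hout) U)|
          ≤ Real.sqrt A₁ * Real.sqrt (2 * (B₁ + B₀)) := by
      intro μ
      have hvan : ∀ x, x ∉ lev n (fineDom_mono hn hΩ) hout 4 →
          fld (covDeriv n _ (lnk F e n Ωc Ac) μ *ᵥ smulF (thF n (fineDom_mono hn hΩ) hout) U) x = 0 := by
        intro x hx
        refine fld_covDeriv_smulF_eq_zero _ μ U (hθ0' x hx) fun hm' => ?_
        by_contra hne
        exact hx (h34 (mem_lev_of_edistR_le (mem_lev_of_thF_ne_zero hn (fineDom_mono hn hΩ) hout hne)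
          (by rw [edistR_comm]; exact edistR_fwd_le_one hn μ x hm')))
      rw [dot_eq_sum_of_vanish _ _ _ hvan]
      refine (abs_sum_fld_dot_le _ _ _).trans (mul_le_mul (Real.sqrt_le_sqrt (hA1' μ)) (Real.sqrt_le_sqrt ?_)
        (Real.sqrt_nonneg _) (Real.sqrt_nonneg _))
      calc _ ≤ ∑ x ∈ lev n (fineDom_mono hn hΩ) hout 4, 2 * (fld (covDeriv n _ (lnk F e n Ωc Ac) μ *ᵥ U) x
              ⬝ᵥ fld (covDeriv n _ (lnk F e n Ωc Ac) μ *ᵥ U) x + fld U x ⬝ᵥ fld U x) :=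
            Finset.sum_le_sum fun x _ => fld_covDeriv_smulF_sq_le _ μ hθ1 (hj1 μ) U x
        _ = 2 * (∑ x ∈ lev n (fineDom_mono hn hΩ) hout 4, fld (covDeriv n _ (lnk F e n Ωc Ac) μ *ᵥ U) x
              ⬝ᵥ fld (covDeriv n _ (lnk F e n Ωc Ac) μ *ᵥ U) x
              + ∑ x ∈ lev n (fineDom_mono hn hΩ) hout 4, fld U x ⬝ᵥ fld U x) := by
            rw [← Finset.sum_add_distrib, Finset.mul_sum]
        _ ≤ 2 * (B₁ + B₀) := by linarith [hB1' μ, hB0]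
    calc _ ≤ ∑ μ, |(covDeriv n _ (lnk F e n Ωc Ac) μ *ᵥ V)
            ⬝ᵥ (covDeriv n _ (lnk F e n Ωc Ac) μ *ᵥ smulF (thF n (fineDom_mono hn hΩ) hout) U)| := Finset.abs_sum_le_sum_abs _ _
      _ ≤ ∑ _μ : Fin (d + 1), Real.sqrt A₁ * Real.sqrt (2 * (B₁ + B₀)) := Finset.sum_le_sum fun μ _ => hμ μ
      _ = ((d : ℝ) + 1) * Real.sqrt A₁ * Real.sqrt (2 * (B₁ + B₀)) := by
          rw [Finset.sum_const, Finset.card_univ, Fintype.card_fin, nsmul_eq_mul]; push_cast; ring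
  -- (2) the mass
  have h2 : |V ⬝ᵥ smulF (thF n (fineDom_mono hn hΩ) hout) U| ≤ Real.sqrt A₀ * Real.sqrt B₀ := by
    rw [dot_eq_sum_of_vanish _ _ _ hvanU]
    exact (abs_sum_fld_dot_le _ _ _).trans (mul_le_mul (Real.sqrt_le_sqrt hA0)
      (Real.sqrt_le_sqrt ((Finset.sum_le_sum fun x _ => hθU x).trans hB0)) (Real.sqrt_nonneg _)
      (Real.sqrt_nonneg _))
  -- (3) the averaging term
  have hTo : ∀ (y : ↥Ωc) (x : ↥(fineDom n Ωc)), (trn F e hn Ωc Ac y x)ᵀ * trn F e hn Ωc Ac y x = 1 := by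
    intro y x
    simp only [trn, lnk, contourTrans, transport_fieldLink]
    exact F.orth _
  have hw : ∀ x, x ∉ lev n (fineDom_mono hn hΩ) hout 3 → fld (smulF (thF n (fineDom_mono hn hΩ) hout) U) x = 0 := fun x hx => by
    rw [fld_smulF, hθ0 x hx, zero_smul]
  have hS' : ∀ x x' : ↥(fineDom n Ωc), x' ∈ lev n (fineDom_mono hn hΩ) hout 3 → blk n x.1 = blk n x'.1 → x ∈ lev n (fineDom_mono hn hΩ) hout 4 :=
    fun x x' hx' hb => h34 (mem_lev_of_edistR_le hx' (edistR_le_one_of_blk_eq hn hb.symm))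
  have h3' : |V ⬝ᵥ (projOp (rBlkWt n Ωc (fineDom n Ωc)) (trn F e hn Ωc Ac) *ᵥ smulF (thF n (fineDom_mono hn hΩ) hout) U)|
      ≤ (n : ℝ) ^ (d + 1) * Real.sqrt A₀ * Real.sqrt B₀ := by
    refine (abs_dot_projOp_le hn Ωc _ hTo V _ _ _ hw hS').trans ?_
    rw [mul_assoc, mul_assoc]
    exact mul_le_mul_of_nonneg_left (mul_le_mul (Real.sqrt_le_sqrt hA0) (Real.sqrt_le_sqrt hθU')
      (Real.sqrt_nonneg _) (Real.sqrt_nonneg _)) hNd.le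
  -- combine
  rw [hdec]
  refine (abs_add_three _ _ _).trans ?_
  rw [abs_mul, abs_of_nonneg hm, abs_mul, abs_of_nonneg (by positivity : (0 : ℝ) ≤ a * ((n : ℝ) ^ (d + 1))⁻¹)]
  have h3'' : a * ((n : ℝ) ^ (d + 1))⁻¹
      * |V ⬝ᵥ (projOp (rBlkWt n Ωc (fineDom n Ωc)) (trn F e hn Ωc Ac) *ᵥ smulF (thF n (fineDom_mono hn hΩ) hout) U)|
        ≤ a * (Real.sqrt A₀ * Real.sqrt B₀) := by
    calc _ ≤ a * ((n : ℝ) ^ (d + 1))⁻¹ * ((n : ℝ) ^ (d + 1) * Real.sqrt A₀ * Real.sqrt B₀) :=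
          mul_le_mul_of_nonneg_left h3' (by positivity)
      _ = a * (((n : ℝ) ^ (d + 1))⁻¹ * (n : ℝ) ^ (d + 1)) * (Real.sqrt A₀ * Real.sqrt B₀) := by ring
      _ = a * (Real.sqrt A₀ * Real.sqrt B₀) := by rw [inv_mul_cancel₀ hNd.ne', mul_one]
  have h2' : m2 * |V ⬝ᵥ smulF (thF n (fineDom_mono hn hΩ) hout) U| ≤ m2 * (Real.sqrt A₀ * Real.sqrt B₀) :=
    mul_le_mul_of_nonneg_left h2 hm
  linarith

end Region

/-! ## §9  The constants and Corollary 2.3, `δG` clause, at `A ≠ 0` -/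

section Consts

/-- THE CONSTANT OF THE FORM BOUND: `K₂(d,σ,a) = (d+1)√K₁ √(2(K₁ + K₀/σ)) + K₀ + aK₀/σ`. [folklore] -/
def K2 (d : ℕ) (σ a : ℝ) : ℝ :=
  ((d : ℝ) + 1) * Real.sqrt (K1 σ) * Real.sqrt (2 * (K1 σ + K0 σ / σ)) + K0 σ + a * K0 σ / σ

/-- `K₂ ≥ 0`. [folklore] -/
theorem K2_nonneg (d : ℕ) {σ a : ℝ} (hσ : 0 < σ) (ha : 0 ≤ a) : 0 ≤ K2 d σ a := by
  have := K0_nonneg hσ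
  unfold K2; positivity

/-- **THE COLLAR FORM BOUND IN CLOSED FORM**: with `A₀ = (K₀/σ')x_f²`, `A₁ = K₁x_f²`, `B₀ = (K₀/σ')x_g²`,
`B₁ = K₁x_g²`, `σ' = σ + m²`: `(d+1)√A₁√(2(B₁+B₀)) + (m²+a)√A₀√B₀ ≤ K₂(d,σ,a)·x_f·x_g` — uniformly in `m² ≥ 0`
(`m²K₀/σ' ≤ K₀`). [folklore] -/
theorem T2_consts_le (d : ℕ) {σ m2 a xf xg : ℝ} (hσ : 0 < σ) (hm : 0 ≤ m2) (ha : 0 ≤ a) (hxf : 0 ≤ xf)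
    (hxg : 0 ≤ xg) :
    ((d : ℝ) + 1) * Real.sqrt (K1 σ * xf ^ 2) * Real.sqrt (2 * (K1 σ * xg ^ 2 + K0 σ / (σ + m2) * xg ^ 2))
        + (m2 + a) * Real.sqrt (K0 σ / (σ + m2) * xf ^ 2) * Real.sqrt (K0 σ / (σ + m2) * xg ^ 2)
      ≤ K2 d σ a * xf * xg := by
  have hσ' : 0 < σ + m2 := by linarith
  have hK0 : 0 ≤ K0 σ := K0_nonneg hσ
  have hK1 : 0 ≤ K1 σ := K1_nonneg σ
  have hq : 0 ≤ K0 σ / (σ + m2) := div_nonneg hK0 hσ'.le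
  have e1 : Real.sqrt (K1 σ * xf ^ 2) = Real.sqrt (K1 σ) * xf := by rw [Real.sqrt_mul hK1, Real.sqrt_sq hxf]
  have e2 : Real.sqrt (2 * (K1 σ * xg ^ 2 + K0 σ / (σ + m2) * xg ^ 2))
      = Real.sqrt (2 * (K1 σ + K0 σ / (σ + m2))) * xg := by
    rw [show 2 * (K1 σ * xg ^ 2 + K0 σ / (σ + m2) * xg ^ 2) = 2 * (K1 σ + K0 σ / (σ + m2)) * xg ^ 2 by ring,
      Real.sqrt_mul (by positivity), Real.sqrt_sq hxg]
  have e3 : Real.sqrt (K0 σ / (σ + m2) * xf ^ 2) = Real.sqrt (K0 σ / (σ + m2)) * xf := by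
    rw [Real.sqrt_mul hq, Real.sqrt_sq hxf]
  have e4 : Real.sqrt (K0 σ / (σ + m2) * xg ^ 2) = Real.sqrt (K0 σ / (σ + m2)) * xg := by
    rw [Real.sqrt_mul hq, Real.sqrt_sq hxg]
  rw [e1, e2, e3, e4]
  have hdiv : K0 σ / (σ + m2) ≤ K0 σ / σ := div_le_div_of_nonneg_left hK0 hσ (by linarith)
  have h5 : Real.sqrt (2 * (K1 σ + K0 σ / (σ + m2))) ≤ Real.sqrt (2 * (K1 σ + K0 σ / σ)) :=
    Real.sqrt_le_sqrt (by linarith)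
  have h6 : Real.sqrt (K0 σ / (σ + m2)) * Real.sqrt (K0 σ / (σ + m2)) = K0 σ / (σ + m2) := Real.mul_self_sqrt hq
  have h7 : (m2 + a) * (K0 σ / (σ + m2)) ≤ K0 σ + a * K0 σ / σ := by
    have h71 : m2 * (K0 σ / (σ + m2)) ≤ K0 σ := by
      rw [← mul_div_assoc, div_le_iff₀ hσ']; nlinarith
    have h72 : a * (K0 σ / (σ + m2)) ≤ a * K0 σ / σ := by
      rw [mul_div_assoc]; exact mul_le_mul_of_nonneg_left hdiv ha
    linarith
  have hxx : 0 ≤ xf * xg := mul_nonneg hxf hxg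
  unfold K2
  calc ((d : ℝ) + 1) * (Real.sqrt (K1 σ) * xf) * (Real.sqrt (2 * (K1 σ + K0 σ / (σ + m2))) * xg)
        + (m2 + a) * (Real.sqrt (K0 σ / (σ + m2)) * xf) * (Real.sqrt (K0 σ / (σ + m2)) * xg)
      = ((d : ℝ) + 1) * Real.sqrt (K1 σ) * Real.sqrt (2 * (K1 σ + K0 σ / (σ + m2))) * (xf * xg)
        + (m2 + a) * (Real.sqrt (K0 σ / (σ + m2)) * Real.sqrt (K0 σ / (σ + m2))) * (xf * xg) := by ring
    _ ≤ ((d : ℝ) + 1) * Real.sqrt (K1 σ) * Real.sqrt (2 * (K1 σ + K0 σ / σ)) * (xf * xg)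
        + (K0 σ + a * K0 σ / σ) * (xf * xg) := by
        rw [h6]
        exact add_le_add (mul_le_mul_of_nonneg_right (mul_le_mul_of_nonneg_left h5 (by positivity)) hxx)
          (mul_le_mul_of_nonneg_right h7 hxx)
    _ = _ := by ring

/-- `K₂(d,a) = K₂(d, min(2,a)/4, a)`. [folklore] -/
def K2R (d : ℕ) (a : ℝ) : ℝ := K2 d (min 2 a / 4) a

/-- **THE CONSTANT `c₁(d,a)` OF THE `δG` CLAUSE, EXPLICIT**: `c₁ = 2e⁴(c₀ + √(c₀K₂))` with `c₀ = c₀(a)` of the main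
clause. [cite: Balaban1983RegularityDecay, p. 581 Corollary 2.3 (δG clause)] -/
def c1R (d : ℕ) (a : ℝ) : ℝ := 2 * Real.exp 4 * (c0R a + Real.sqrt (c0R a * K2R d a))

/-- `2c₀ ≤ c₁`. [folklore] -/
theorem two_c0R_le_c1R (d : ℕ) {a : ℝ} (ha : 0 < a) : 2 * c0R a ≤ c1R d a := by
  unfold c1R
  have h1 : (1 : ℝ) ≤ Real.exp 4 := Real.one_le_exp (by norm_num)
  have h2 := (c0R_pos ha).le
  have h3 := Real.sqrt_nonneg (c0R a * K2R d a)
  nlinarith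

end Consts

section Main

variable {d : ℕ} {ι : Type*} [Fintype ι] [DecidableEq ι]

variable (F : OrthFlow ι) {ℓ : ℝ} (hℓ : 0 ≤ ℓ)
  (hLip : ∀ t (v : ι → ℝ), ((F.U t - 1) *ᵥ v) ⬝ᵥ ((F.U t - 1) *ᵥ v) ≤ (ℓ * t) ^ 2 * (v ⬝ᵥ v))
  {e : ℝ} (he : 0 < e) {n : ℕ} (hn : 1 ≤ n) {a : ℝ} (ha : 0 < a) {m2 : ℝ} (hm : 0 ≤ m2)
  {Ωc Ω₀c : Finset (Fin (d + 1) → ℤ)} (hΩ : Ωc ⊆ Ω₀c) {Ac : (Fin (d + 1) → ℤ) → Fin (d + 1) → ℝ} {c β : ℝ}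
  (hc : 0 ≤ c)
  (h17 : ∀ x ∈ fineDom n Ω₀c, ∀ μ ν : Fin (d + 1), |Ac (x + e1 μ) ν - Ac x ν| ≤ c * e ^ (β - 1) / n)
  (hsmall : ℓ ^ 2 * ((d + 1) * c * e ^ β) ^ 2 * (d + 1) * (1 + a * (d + 1)) ≤ min 2 a / 4)

include hℓ hLip he ha hm hc h17 hsmall

set_option maxHeartbeats 400000 in
/-- **THE MASTER ESTIMATE, TWIST-INDEXED**: `|⟨f̃, δG_k(Ω,Ω₀,A) g̃⟩| ≤ c₁ e^{−(δ₀/2)(Δ + ρ_f + ρ_g)}‖f‖₂‖g‖₂` for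
`f̃ ∈ {f, D_μ^*f}`, `g̃ ∈ {g, D_ν^*g}`, `Δ = dist_η(supp f, supp g)`, `ρ = dist_η(supp ·, Ω₀∖Ω)`.
[cite: Balaban1983RegularityDecay, p. 581 Corollary 2.3 (δG clause)] [cite: CombesThomas1973, §II] -/
theorem dmaster (b b' : Bool) (μ ν : Fin (d + 1)) (f g : ↥(fineDom n Ωc) × ι → ℝ) :
    |twV n (fineDom n Ωc) (lnk F e n Ωc Ac) b μ f
        ⬝ᵥ dGv (fineDom_mono hn hΩ) (regionOp F e hn a m2 Ωc Ac)⁻¹ (regionOp F e hn a m2 Ω₀c Ac)⁻¹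
          (twV n (fineDom n Ωc) (lnk F e n Ωc Ac) b' ν g)|
      ≤ c1R d a * Real.exp (-(delta0R d a / 2 * (bsuppDist n (fineDom n Ωc) f g
          + bdistV n (fineDom_mono hn hΩ) f + bdistV n (fineDom_mono hn hΩ) g))) * bl2n f * bl2n g := by
  obtain ⟨hδ0, hδ1, hct⟩ := delta0R_admissible d ha
  have hσ : 0 < min 2 a / 4 := div_pos (lt_min two_pos ha) four_pos
  have h17' : ∀ x ∈ fineDom n Ωc, ∀ μ ν : Fin (d + 1), |Ac (x + e1 μ) ν - Ac x ν| ≤ c * e ^ (β - 1) / n :=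
    fun x hx => h17 x (fineDom_mono hn hΩ hx)
  have hI := ctHyp_region F hℓ hLip he hn ha hm Ωc hc h17' hsmall hδ0 hδ1 hct
  have hI₀ := ctHyp_region F hℓ hLip he hn ha hm Ω₀c hc h17 hsmall hδ0 hδ1 hct
  have hM := ctHyp_region_mass F hℓ hLip he hn ha hm Ωc hc h17' hsmall hδ0 hδ1 hct
  have hM₀ := ctHyp_region_mass F hℓ hLip he hn ha hm Ω₀c hc h17 hsmall hδ0 hδ1 hct
  have hσσ : min 2 a / 4 ≤ min 2 a / 4 + m2 := le_add_of_nonneg_right hm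
  -- abbreviations (values only)
  have hc0 : 0 < c0R a := c0R_pos ha
  have h2c0 : 0 ≤ 2 * c0R a := mul_nonneg zero_le_two hc0.le
  have hΔ0 : 0 ≤ bsuppDist n (fineDom n Ωc) f g := bsuppDist_nonneg f g
  have hρf0 : 0 ≤ bdistV n (fineDom_mono hn hΩ) f := bdistV_nonneg (fineDom_mono hn hΩ) f
  have hρg0 : 0 ≤ bdistV n (fineDom_mono hn hΩ) g := bdistV_nonneg (fineDom_mono hn hΩ) g
  have hNf : 0 ≤ bl2n f := Real.sqrt_nonneg _
  have hNg : 0 ≤ bl2n g := Real.sqrt_nonneg _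
  have hN : 0 ≤ bl2n f * bl2n g := mul_nonneg hNf hNg
  -- supports and distances
  have hfS : ∀ j : ↥(fineDom n Ωc) × ι, j.1 ∉ bsupp f → f j = 0 := eq_zero_of_not_mem_bsupp f
  have hgS : ∀ j : ↥(fineDom n Ωc) × ι, j.1 ∉ bsupp g → g j = 0 := eq_zero_of_not_mem_bsupp g
  have hΔ : ∀ x ∈ bsupp f, ∀ t ∈ bsupp g, bsuppDist n (fineDom n Ωc) f g ≤ edistR n (fineDom n Ωc) x t :=
    fun x hx t ht => bsuppDist_le f g hx ht
  have hΔ₀ : ∀ z ∈ (bsupp f).map (inclEmb (fineDom_mono hn hΩ)), ∀ w ∈ (bsupp g).map (inclEmb (fineDom_mono hn hΩ)),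
      bsuppDist n (fineDom n Ωc) f g ≤ edistR n (fineDom n Ω₀c) z w := by
    intro z hz w hw
    rw [Finset.mem_map] at hz hw
    obtain ⟨x, hx, rfl⟩ := hz
    obtain ⟨s, hs, rfl⟩ := hw
    show _ ≤ edistR n (fineDom n Ω₀c) (incl (fineDom_mono hn hΩ) x) (incl (fineDom_mono hn hΩ) s)
    rw [edistR_incl]
    exact bsuppDist_le f g hx hs
  -- STANDARD BOUND: `|P| ≤ 2c₀e^{−δ₀Δ}N`
  have hP1 : |twV n _ (lnk F e n Ωc Ac) b μ f ⬝ᵥ ((regionOp F e hn a m2 Ωc Ac)⁻¹ *ᵥ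
      twV n _ (lnk F e n Ωc Ac) b' ν g)|
        ≤ c0R a * Real.exp (-(delta0R d a * bsuppDist n (fineDom n Ωc) f g)) * bl2n f * bl2n g :=
    abs_twV_pair_le hI _ _ _ hΔ f g hfS hgS b b' μ ν
  have hP2 : |twV n _ (lnk F e n Ωc Ac) b μ f ⬝ᵥ resV (fineDom_mono hn hΩ) ((regionOp F e hn a m2 Ω₀c Ac)⁻¹ *ᵥ
      extV (fineDom n Ω₀c) (twV n _ (lnk F e n Ωc Ac) b' ν g))|
        ≤ c0R a * Real.exp (-(delta0R d a * bsuppDist n (fineDom n Ωc) f g)) * bl2n f * bl2n g := by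
    rw [← extV_dotProduct (fineDom_mono hn hΩ), extV_twV F e hn hΩ Ac, extV_twV F e hn hΩ Ac]
    refine (abs_twV_pair_le hI₀ _ _ _ hΔ₀ _ _ (extV_ftw_eq_zero (fineDom_mono hn hΩ) b μ f) (extV_ftw_eq_zero (fineDom_mono hn hΩ) b' ν g)
      b b' μ ν).trans ?_
    have hE : 0 ≤ c0R a * Real.exp (-(delta0R d a * bsuppDist n (fineDom n Ωc) f g)) :=
      mul_nonneg hc0.le (Real.exp_nonneg _)
    exact mul_le_mul (mul_le_mul_of_nonneg_left (bl2n_extV_ftw_le (fineDom_mono hn hΩ) b μ f) hE) (bl2n_extV_ftw_le (fineDom_mono hn hΩ) b' ν g)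
      (Real.sqrt_nonneg _) (mul_nonneg hE hNf)
  have hSTD : |twV n _ (lnk F e n Ωc Ac) b μ f ⬝ᵥ dGv (fineDom_mono hn hΩ) (regionOp F e hn a m2 Ωc Ac)⁻¹
      (regionOp F e hn a m2 Ω₀c Ac)⁻¹ (twV n _ (lnk F e n Ωc Ac) b' ν g)|
        ≤ 2 * (c0R a * Real.exp (-(delta0R d a * bsuppDist n (fineDom n Ωc) f g)) * bl2n f * bl2n g) := by
    rw [dGv, dotProduct_sub]
    refine (abs_sub _ _).trans ?_
    linarith
  -- the target exponential dominates the standard one up to the boundary factors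
  by_cases hout : (outR (fineDom n Ωc) (fineDom n Ω₀c)).Nonempty
  swap
  · -- no fine point in `Ω₀∖Ω`: the boundary distances vanish and the standard bound suffices
    rw [bdistV_eq_zero (fineDom_mono hn hΩ) f hout, bdistV_eq_zero (fineDom_mono hn hΩ) g hout, add_zero, add_zero]
    have hexp : Real.exp (-(delta0R d a * bsuppDist n (fineDom n Ωc) f g))
        ≤ Real.exp (-(delta0R d a / 2 * bsuppDist n (fineDom n Ωc) f g)) :=
      Real.exp_le_exp.2 (by linarith [mul_nonneg hδ0 hΔ0])
    have h2c := two_c0R_le_c1R d ha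
    calc _ ≤ 2 * (c0R a * Real.exp (-(delta0R d a * bsuppDist n (fineDom n Ωc) f g)) * bl2n f * bl2n g) := hSTD
      _ = (2 * c0R a) * Real.exp (-(delta0R d a * bsuppDist n (fineDom n Ωc) f g)) * (bl2n f * bl2n g) := by ring
      _ ≤ c1R d a * Real.exp (-(delta0R d a / 2 * bsuppDist n (fineDom n Ωc) f g)) * (bl2n f * bl2n g) :=
          mul_le_mul_of_nonneg_right (mul_le_mul h2c hexp (Real.exp_nonneg _) (by linarith)) hN
      _ = _ := by ring
  -- THE CUTOFF REPRESENTATION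
  have hcut := dot_dGv_eq_cutoff F e hn a m2 hΩ Ac hM.pos hM.coercive hM₀.coercive (thF n (fineDom_mono hn hΩ) hout)
    (fun x hx => thF_eq_one_of_mem_bdR hn (fineDom_mono hn hΩ) hout hx) (twV n _ (lnk F e n Ωc Ac) b μ f)
    (twV n _ (lnk F e n Ωc Ac) b' ν g)
  -- forms on the collar (computed before the exponentials are named, so that the names propagate)
  have hFm := fside_masses F e hn a m2 hΩ Ac hout hM₀ hσ hσσ b μ f
  have hGm := gside_masses F e hn a m2 hΩ Ac hout hM hσ hσσ b' ν g
  -- names for the exponentials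
  set Δ := bsuppDist n (fineDom n Ωc) f g with hΔdef
  set ρf := bdistV n (fineDom_mono hn hΩ) f with hρfdef
  set ρg := bdistV n (fineDom_mono hn hΩ) g with hρgdef
  set δ₀ := delta0R d a with hδdef
  set Efull := Real.exp (-(δ₀ / 2 * (Δ + ρf + ρg))) with hEfull
  set xf := Real.exp (-(δ₀ * (ρf - 4))) * bl2n f with hxf
  set xg := Real.exp (-(δ₀ * (ρg - 4))) * bl2n g with hxg
  have hEfull0 : 0 < Efull := Real.exp_pos _
  have hxf0 : 0 ≤ xf := mul_nonneg (Real.exp_nonneg _) hNf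
  have hxg0 : 0 ≤ xg := mul_nonneg (Real.exp_nonneg _) hNg
  -- T1
  have hT1 : |twV n _ (lnk F e n Ωc Ac) b μ f ⬝ᵥ smulF (thF n (fineDom_mono hn hΩ) hout)
      ((regionOp F e hn a m2 Ωc Ac)⁻¹ *ᵥ twV n _ (lnk F e n Ωc Ac) b' ν g)|
        ≤ 2 * c0R a * Real.exp 4 * Efull * (bl2n f * bl2n g)
      ∧ |twV n _ (lnk F e n Ωc Ac) b μ f ⬝ᵥ smulF (thF n (fineDom_mono hn hΩ) hout)
      ((regionOp F e hn a m2 Ωc Ac)⁻¹ *ᵥ twV n _ (lnk F e n Ωc Ac) b' ν g)|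
        ≤ 2 * c0R a * Real.exp (-(δ₀ * Δ)) * (bl2n f * bl2n g) := by
    by_cases hne : ∃ x ∈ bsupp f, x ∈ lev n (fineDom_mono hn hΩ) hout 4
    · obtain ⟨x₀, hx₀, hx₀L⟩ := hne
      have hρf4 : ρf ≤ 4 := (bdistV_le_dout (fineDom_mono hn hΩ) hout f hx₀).trans (mem_lev.1 hx₀L)
      have hρ₁ : ∀ x ∈ bsupp f, x ∈ lev n (fineDom_mono hn hΩ) hout 4 → ∀ t ∈ bsupp g,
          max Δ (ρg - 4) ≤ edistR n (fineDom n Ωc) x t :=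
        fun x hx hxL t ht => max_le (bsuppDist_le f g hx ht) (le_edistR_of_mem_lev hxL g ht)
      have h := abs_T1_le F e hn a m2 hΩ Ac hout hI f g b b' μ ν _ hρ₁
      rw [show cR (min 2 a / 4) = c0R a from rfl] at h
      have hm1 : Real.exp (-(δ₀ * max Δ (ρg - 4))) ≤ Real.exp 4 * Efull := by
        rw [hEfull, ← Real.exp_add]
        refine Real.exp_le_exp.2 ?_
        have a1 := mul_le_mul_of_nonneg_left (le_max_left Δ (ρg - 4)) hδ0
        have a2 := mul_le_mul_of_nonneg_left (le_max_right Δ (ρg - 4)) hδ0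
        have a3 := mul_le_mul_of_nonneg_left hρf4 hδ0
        linarith
      have hm2 : Real.exp (-(δ₀ * max Δ (ρg - 4))) ≤ Real.exp (-(δ₀ * Δ)) :=
        Real.exp_le_exp.2 (by linarith [mul_le_mul_of_nonneg_left (le_max_left Δ (ρg - 4)) hδ0])
      constructor
      · calc _ ≤ _ := h
          _ = 2 * c0R a * Real.exp (-(δ₀ * max Δ (ρg - 4))) * (bl2n f * bl2n g) := by ring
          _ ≤ 2 * c0R a * (Real.exp 4 * Efull) * (bl2n f * bl2n g) :=
              mul_le_mul_of_nonneg_right (mul_le_mul_of_nonneg_left hm1 h2c0) hN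
          _ = _ := by ring
      · calc _ ≤ _ := h
          _ = 2 * c0R a * Real.exp (-(δ₀ * max Δ (ρg - 4))) * (bl2n f * bl2n g) := by ring
          _ ≤ _ := mul_le_mul_of_nonneg_right (mul_le_mul_of_nonneg_left hm2 h2c0) hN
    · -- no point of `supp f` within distance `4`: the hypothesis of `abs_T1_le` is vacuous for every `ρ₁`
      have hρ₁ : ∀ ρ₁ : ℝ, ∀ x ∈ bsupp f, x ∈ lev n (fineDom_mono hn hΩ) hout 4 → ∀ t ∈ bsupp g,
          ρ₁ ≤ edistR n (fineDom n Ωc) x t := fun ρ₁ x hx hxL => absurd ⟨x, hx, hxL⟩ hne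
      have h := abs_T1_le F e hn a m2 hΩ Ac hout hI f g b b' μ ν (Δ + ρf + ρg) (hρ₁ _)
      rw [show cR (min 2 a / 4) = c0R a from rfl] at h
      have p1 := mul_nonneg hδ0 hΔ0
      have p2 := mul_nonneg hδ0 hρf0
      have p3 := mul_nonneg hδ0 hρg0
      have hm1 : Real.exp (-(δ₀ * (Δ + ρf + ρg))) ≤ Real.exp 4 * Efull := by
        rw [hEfull, ← Real.exp_add]
        refine Real.exp_le_exp.2 ?_
        linarith
      have hm2 : Real.exp (-(δ₀ * (Δ + ρf + ρg))) ≤ Real.exp (-(δ₀ * Δ)) := Real.exp_le_exp.2 (by linarith)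
      constructor
      · calc _ ≤ _ := h
          _ = 2 * c0R a * Real.exp (-(δ₀ * (Δ + ρf + ρg))) * (bl2n f * bl2n g) := by ring
          _ ≤ 2 * c0R a * (Real.exp 4 * Efull) * (bl2n f * bl2n g) :=
              mul_le_mul_of_nonneg_right (mul_le_mul_of_nonneg_left hm1 h2c0) hN
          _ = _ := by ring
      · calc _ ≤ _ := h
          _ = 2 * c0R a * Real.exp (-(δ₀ * (Δ + ρf + ρg))) * (bl2n f * bl2n g) := by ring
          _ ≤ _ := mul_le_mul_of_nonneg_right (mul_le_mul_of_nonneg_left hm2 h2c0) hN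
  -- T2, bound (i): from the representation and the standard bound
  have hT2i : |resV (fineDom_mono hn hΩ) ((regionOp F e hn a m2 Ω₀c Ac)⁻¹ *ᵥ extV (fineDom n Ω₀c) (twV n _ (lnk F e n Ωc Ac) b μ f))
      ⬝ᵥ (regionOp F e hn a m2 Ωc Ac *ᵥ smulF (thF n (fineDom_mono hn hΩ) hout)
        ((regionOp F e hn a m2 Ωc Ac)⁻¹ *ᵥ twV n _ (lnk F e n Ωc Ac) b' ν g))|
        ≤ 4 * c0R a * Real.exp (-(δ₀ * Δ)) * (bl2n f * bl2n g) := by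
    have h := hT1.2
    have hs := hSTD
    rw [hcut, abs_sub_comm] at hs
    -- |B| - |A| ≤ |B - A|
    have key := (abs_sub_abs_le_abs_sub _ _).trans hs
    linarith
  -- T2, bound (ii): forms on the collar
  have hT2ii : |resV (fineDom_mono hn hΩ) ((regionOp F e hn a m2 Ω₀c Ac)⁻¹ *ᵥ extV (fineDom n Ω₀c) (twV n _ (lnk F e n Ωc Ac) b μ f))
      ⬝ᵥ (regionOp F e hn a m2 Ωc Ac *ᵥ smulF (thF n (fineDom_mono hn hΩ) hout)
        ((regionOp F e hn a m2 Ωc Ac)⁻¹ *ᵥ twV n _ (lnk F e n Ωc Ac) b' ν g))|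
        ≤ K2R d a * xf * xg := by
    rw [extV_twV F e hn hΩ Ac]
    refine (abs_dot_regionOp_smulF_le F e hn a m2 hΩ Ac ha.le hm hout _ _ hFm.1 hFm.2 hGm.1 hGm.2).trans ?_
    exact T2_consts_le d hσ hm ha.le hxf0 hxg0
  -- the geometric mean of (i) and (ii)
  have hK2 : 0 ≤ K2R d a := K2_nonneg d hσ ha.le
  have hprod : 4 * c0R a * Real.exp (-(δ₀ * Δ)) * (bl2n f * bl2n g) * (K2R d a * xf * xg)
      ≤ (2 * Real.exp 4 * Real.sqrt (c0R a * K2R d a) * Efull * (bl2n f * bl2n g)) ^ 2 := by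
    have hexp : Real.exp (-(δ₀ * Δ)) * (Real.exp (-(δ₀ * (ρf - 4))) * Real.exp (-(δ₀ * (ρg - 4))))
        ≤ Real.exp 4 ^ 2 * Efull ^ 2 := by
      rw [hEfull, sq, sq, ← Real.exp_add, ← Real.exp_add, ← Real.exp_add, ← Real.exp_add, ← Real.exp_add]
      exact Real.exp_le_exp.2 (by linarith)
    have hsq : Real.sqrt (c0R a * K2R d a) ^ 2 = c0R a * K2R d a := Real.sq_sqrt (mul_nonneg hc0.le hK2)
    have hcK : 0 ≤ 4 * (c0R a * K2R d a) * (bl2n f * bl2n g) ^ 2 :=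
      mul_nonneg (mul_nonneg zero_le_four (mul_nonneg hc0.le hK2)) (sq_nonneg _)
    calc 4 * c0R a * Real.exp (-(δ₀ * Δ)) * (bl2n f * bl2n g) * (K2R d a * xf * xg)
        = 4 * (c0R a * K2R d a) * (bl2n f * bl2n g) ^ 2
          * (Real.exp (-(δ₀ * Δ)) * (Real.exp (-(δ₀ * (ρf - 4))) * Real.exp (-(δ₀ * (ρg - 4))))) := by
          rw [hxf, hxg]; ring
      _ ≤ 4 * (c0R a * K2R d a) * (bl2n f * bl2n g) ^ 2 * (Real.exp 4 ^ 2 * Efull ^ 2) :=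
          mul_le_mul_of_nonneg_left hexp hcK
      _ = (2 * Real.exp 4 * Real.sqrt (c0R a * K2R d a) * Efull * (bl2n f * bl2n g)) ^ 2 := by
          rw [show (2 * Real.exp 4 * Real.sqrt (c0R a * K2R d a) * Efull * (bl2n f * bl2n g)) ^ 2
              = 4 * Real.exp 4 ^ 2 * Real.sqrt (c0R a * K2R d a) ^ 2 * Efull ^ 2 * (bl2n f * bl2n g) ^ 2 by ring,
            hsq]
          ring
  have hT2 : |resV (fineDom_mono hn hΩ) ((regionOp F e hn a m2 Ω₀c Ac)⁻¹ *ᵥ extV (fineDom n Ω₀c) (twV n _ (lnk F e n Ωc Ac) b μ f))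
      ⬝ᵥ (regionOp F e hn a m2 Ωc Ac *ᵥ smulF (thF n (fineDom_mono hn hΩ) hout)
        ((regionOp F e hn a m2 Ωc Ac)⁻¹ *ᵥ twV n _ (lnk F e n Ωc Ac) b' ν g))|
        ≤ 2 * Real.exp 4 * Real.sqrt (c0R a * K2R d a) * Efull * (bl2n f * bl2n g) := by
    have hX : 0 ≤ 2 * Real.exp 4 * Real.sqrt (c0R a * K2R d a) * Efull * (bl2n f * bl2n g) :=
      mul_nonneg (mul_nonneg (mul_nonneg (mul_nonneg zero_le_two (Real.exp_nonneg _)) (Real.sqrt_nonneg _))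
        hEfull0.le) hN
    calc _ ≤ Real.sqrt (4 * c0R a * Real.exp (-(δ₀ * Δ)) * (bl2n f * bl2n g) * (K2R d a * xf * xg)) :=
          (Real.sqrt_mul_self (abs_nonneg _)).symm.le.trans
            (Real.sqrt_le_sqrt (mul_le_mul hT2i hT2ii (abs_nonneg _) ((abs_nonneg _).trans hT2i)))
      _ ≤ Real.sqrt ((2 * Real.exp 4 * Real.sqrt (c0R a * K2R d a) * Efull * (bl2n f * bl2n g)) ^ 2) :=
          Real.sqrt_le_sqrt hprod
      _ = _ := Real.sqrt_sq hX
  -- conclusion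
  rw [hcut]
  refine (abs_sub _ _).trans ?_
  calc _ ≤ 2 * c0R a * Real.exp 4 * Efull * (bl2n f * bl2n g)
        + 2 * Real.exp 4 * Real.sqrt (c0R a * K2R d a) * Efull * (bl2n f * bl2n g) := add_le_add hT1.1 hT2
    _ = c1R d a * Efull * bl2n f * bl2n g := by unfold c1R; ring

/-- **B4 COROLLARY 2.3, THE `δG_k(Ω,Ω₀,A)` CLAUSE AT `A ≠ 0`** — «The same inequalities hold for δG_k(Ω,Ω₀,A) with
the additional factor e^{−δ₀(dist(supp f,Ω^c) + dist(supp f',Ω^c))}», for `δG_k(Ω,Ω₀,A) = G_k(Ω,A) − G_k(Ω₀,A)`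
(1.11) on nested finite unions of unit blocks `Ω ⊂ Ω₀`, under (1.7) and the smallness of `e`, with the EXPLICIT
`c₁(d,a)`, rate `δ₀(d,a)/2`, for EVERY mesh, EVERY mass `m² ≥ 0` and EVERY pair of `R^N`-valued `f, f'` on `Ω`:
the four pairings `|⟨f, δG f'⟩|, |⟨f, D^η_{A,μ}δG f'⟩|, |⟨f, δG D^{η*}_{A,ν} f'⟩|, |⟨f, D^η_{A,μ}δG D^{η*}_{A,ν}f'⟩|` are
`≤ c₁ exp(−(δ₀/2)(dist_η(supp f,supp f') + dist_η(supp f,Ω₀∖Ω) + dist_η(supp f',Ω₀∖Ω))) ‖f‖₂‖f'‖₂`.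
[cite: Balaban1983RegularityDecay, p. 581 Corollary 2.3 (δG clause); p. 573 (1.11)] [cite: CombesThomas1973, §II] -/
theorem dcor23_main_region (f f' : ↥(fineDom n Ωc) × ι → ℝ) (μ ν : Fin (d + 1)) :
    |f ⬝ᵥ dGv (fineDom_mono hn hΩ) (regionOp F e hn a m2 Ωc Ac)⁻¹ (regionOp F e hn a m2 Ω₀c Ac)⁻¹ f'|
        ≤ c1R d a * Real.exp (-(delta0R d a / 2 * (bsuppDist n (fineDom n Ωc) f f'
            + bdistV n (fineDom_mono hn hΩ) f + bdistV n (fineDom_mono hn hΩ) f'))) * bl2n f * bl2n f'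
    ∧ |f ⬝ᵥ (regionDeriv F e n Ωc Ac μ *ᵥ
          dGv (fineDom_mono hn hΩ) (regionOp F e hn a m2 Ωc Ac)⁻¹ (regionOp F e hn a m2 Ω₀c Ac)⁻¹ f')|
        ≤ c1R d a * Real.exp (-(delta0R d a / 2 * (bsuppDist n (fineDom n Ωc) f f'
            + bdistV n (fineDom_mono hn hΩ) f + bdistV n (fineDom_mono hn hΩ) f'))) * bl2n f * bl2n f'
    ∧ |f ⬝ᵥ dGv (fineDom_mono hn hΩ) (regionOp F e hn a m2 Ωc Ac)⁻¹ (regionOp F e hn a m2 Ω₀c Ac)⁻¹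
          ((regionDeriv F e n Ωc Ac ν)ᵀ *ᵥ f')|
        ≤ c1R d a * Real.exp (-(delta0R d a / 2 * (bsuppDist n (fineDom n Ωc) f f'
            + bdistV n (fineDom_mono hn hΩ) f + bdistV n (fineDom_mono hn hΩ) f'))) * bl2n f * bl2n f'
    ∧ |f ⬝ᵥ (regionDeriv F e n Ωc Ac μ *ᵥ
          dGv (fineDom_mono hn hΩ) (regionOp F e hn a m2 Ωc Ac)⁻¹ (regionOp F e hn a m2 Ω₀c Ac)⁻¹
            ((regionDeriv F e n Ωc Ac ν)ᵀ *ᵥ f'))|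
        ≤ c1R d a * Real.exp (-(delta0R d a / 2 * (bsuppDist n (fineDom n Ωc) f f'
            + bdistV n (fineDom_mono hn hΩ) f + bdistV n (fineDom_mono hn hΩ) f'))) * bl2n f * bl2n f' := by
  have h00 := dmaster F hℓ hLip he hn ha hm hΩ hc h17 hsmall false false μ ν f f'
  have h10 := dmaster F hℓ hLip he hn ha hm hΩ hc h17 hsmall true false μ ν f f'
  have h01 := dmaster F hℓ hLip he hn ha hm hΩ hc h17 hsmall false true μ ν f f'
  have h11 := dmaster F hℓ hLip he hn ha hm hΩ hc h17 hsmall true true μ ν f f'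
  simp only [twV_false, twV_true] at h00 h10 h01 h11
  refine ⟨h00, ?_, h01, ?_⟩
  · rw [regionDeriv_eq_covDeriv, dot_mulVec_eq_transpose_dot]; exact h10
  · rw [regionDeriv_eq_covDeriv, dot_mulVec_eq_transpose_dot]; exact h11

omit he hm h17 hsmall in
/-- **B4 COROLLARY 2.3, `δG_k(Ω,Ω₀,A)` CLAUSE, PRINTED QUANTIFIER SHAPE** — «there exist positive constants … such
that … The same inequalities hold for δG_k(Ω,Ω₀,A) with the additional factor e^{−δ₀(dist(supp f,Ω^c) +
dist(supp f',Ω^c))}» for «e sufficiently small and … a regular vector field A» (1.7): for a Lipschitz orthogonal flow,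
`a > 0`, `c ≥ 0`, `β > 0` THERE EXIST `c₁, δ₁, e₁ > 0` (the explicit `c1R d a`, `delta0R d a / 2`, and the `e₁` of
`B4Lower18Regular.threshold_exists`) such that for EVERY charge `0 < e ≤ e₁`, EVERY mesh `η = 1/n`, EVERY NESTED pair
`Ω ⊂ Ω₀` of finite unions of unit blocks, EVERY vector field `A` regular on `Ω₀` in the sense (1.7), EVERY mass
`m² ≥ 0`, all `R^N`-valued `f, f'` on `Ω` and all directions, the four `δG` inequalities hold with the factor
`exp(−δ₁(dist_η(supp f,supp f') + dist_η(supp f,Ω₀∖Ω) + dist_η(supp f',Ω₀∖Ω)))`.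
[cite: Balaban1983RegularityDecay, p. 580–581 Corollary 2.3 (2.30) and the δG clause; p. 573 (1.7), (1.11)] -/
theorem dcor23_region_exists {β : ℝ} (hβ : 0 < β) :
    ∃ c₁ δ₁ e₁ : ℝ, 0 < c₁ ∧ 0 < δ₁ ∧ 0 < e₁ ∧
      ∀ ⦃e : ℝ⦄, 0 < e → e ≤ e₁ → ∀ ⦃n : ℕ⦄ (hn : 1 ≤ n) ⦃Ωc Ω₀c : Finset (Fin (d + 1) → ℤ)⦄ (hΩ : Ωc ⊆ Ω₀c)
        (Ac : (Fin (d + 1) → ℤ) → Fin (d + 1) → ℝ),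
        (∀ x ∈ fineDom n Ω₀c, ∀ μ ν : Fin (d + 1), |Ac (x + e1 μ) ν - Ac x ν| ≤ c * e ^ (β - 1) / n) →
        ∀ ⦃m2 : ℝ⦄, 0 ≤ m2 → ∀ (f f' : ↥(fineDom n Ωc) × ι → ℝ) (μ ν : Fin (d + 1)),
          |f ⬝ᵥ dGv (fineDom_mono hn hΩ) (regionOp F e hn a m2 Ωc Ac)⁻¹ (regionOp F e hn a m2 Ω₀c Ac)⁻¹ f'|
              ≤ c₁ * Real.exp (-(δ₁ * (bsuppDist n (fineDom n Ωc) f f'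
                  + bdistV n (fineDom_mono hn hΩ) f + bdistV n (fineDom_mono hn hΩ) f'))) * bl2n f * bl2n f'
          ∧ |f ⬝ᵥ (regionDeriv F e n Ωc Ac μ *ᵥ
                dGv (fineDom_mono hn hΩ) (regionOp F e hn a m2 Ωc Ac)⁻¹ (regionOp F e hn a m2 Ω₀c Ac)⁻¹ f')|
              ≤ c₁ * Real.exp (-(δ₁ * (bsuppDist n (fineDom n Ωc) f f'
                  + bdistV n (fineDom_mono hn hΩ) f + bdistV n (fineDom_mono hn hΩ) f'))) * bl2n f * bl2n f'
          ∧ |f ⬝ᵥ dGv (fineDom_mono hn hΩ) (regionOp F e hn a m2 Ωc Ac)⁻¹ (regionOp F e hn a m2 Ω₀c Ac)⁻¹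
                ((regionDeriv F e n Ωc Ac ν)ᵀ *ᵥ f')|
              ≤ c₁ * Real.exp (-(δ₁ * (bsuppDist n (fineDom n Ωc) f f'
                  + bdistV n (fineDom_mono hn hΩ) f + bdistV n (fineDom_mono hn hΩ) f'))) * bl2n f * bl2n f'
          ∧ |f ⬝ᵥ (regionDeriv F e n Ωc Ac μ *ᵥ
                dGv (fineDom_mono hn hΩ) (regionOp F e hn a m2 Ωc Ac)⁻¹ (regionOp F e hn a m2 Ω₀c Ac)⁻¹
                  ((regionDeriv F e n Ωc Ac ν)ᵀ *ᵥ f'))|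
              ≤ c₁ * Real.exp (-(δ₁ * (bsuppDist n (fineDom n Ωc) f f'
                  + bdistV n (fineDom_mono hn hΩ) f + bdistV n (fineDom_mono hn hΩ) f'))) * bl2n f * bl2n f' := by
  obtain ⟨e₁, he₁, hsm⟩ := threshold_exists ℓ ((d + 1) * c) ha hβ d
  refine ⟨c1R d a, delta0R d a / 2, e₁, (mul_pos two_pos (c0R_pos ha)).trans_le (two_c0R_le_c1R d ha),
    half_pos (delta0R_pos d ha), he₁, ?_⟩
  intro e he hle n hn Ωc Ω₀c hΩ Ac h17 m2 hm f f' μ ν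
  have hsm' : ℓ ^ 2 * ((d + 1) * c * e ^ β) ^ 2 * (d + 1) * (1 + a * (d + 1)) ≤ min 2 a / 4 := by
    have := hsm e he hle
    simpa only [mul_assoc] using this
  exact dcor23_main_region F hℓ hLip he hn ha hm hΩ hc h17 hsm' f f' μ ν

end Main

/-- the `δG` clause at `A ≠ 0` for the ROTATION FLOW (`N = 2`, `U(t)` = rotation by `t`, `ℓ = 1`): a hypothesis-free
instance of the flow assumptions — non-vacuity of `dcor23_region_exists`.
[cite: Balaban1983RegularityDecay, p. 581 Corollary 2.3 (δG clause)] -/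
theorem dcor23_region_exists_rot {d : ℕ} {a : ℝ} (ha : 0 < a) {c : ℝ} (hc : 0 ≤ c) {β : ℝ} (hβ : 0 < β) :
    ∃ c₁ δ₁ e₁ : ℝ, 0 < c₁ ∧ 0 < δ₁ ∧ 0 < e₁ ∧
      ∀ ⦃e : ℝ⦄, 0 < e → e ≤ e₁ → ∀ ⦃n : ℕ⦄ (hn : 1 ≤ n) ⦃Ωc Ω₀c : Finset (Fin (d + 1) → ℤ)⦄ (hΩ : Ωc ⊆ Ω₀c)
        (Ac : (Fin (d + 1) → ℤ) → Fin (d + 1) → ℝ),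
        (∀ x ∈ fineDom n Ω₀c, ∀ μ ν : Fin (d + 1), |Ac (x + e1 μ) ν - Ac x ν| ≤ c * e ^ (β - 1) / n) →
        ∀ ⦃m2 : ℝ⦄, 0 ≤ m2 → ∀ (f f' : ↥(fineDom n Ωc) × Fin 2 → ℝ) (μ ν : Fin (d + 1)),
          |f ⬝ᵥ dGv (fineDom_mono hn hΩ) (regionOp OrthFlow.rot e hn a m2 Ωc Ac)⁻¹
                (regionOp OrthFlow.rot e hn a m2 Ω₀c Ac)⁻¹ f'|
              ≤ c₁ * Real.exp (-(δ₁ * (bsuppDist n (fineDom n Ωc) f f'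
                  + bdistV n (fineDom_mono hn hΩ) f + bdistV n (fineDom_mono hn hΩ) f'))) * bl2n f * bl2n f'
          ∧ |f ⬝ᵥ (regionDeriv OrthFlow.rot e n Ωc Ac μ *ᵥ
                dGv (fineDom_mono hn hΩ) (regionOp OrthFlow.rot e hn a m2 Ωc Ac)⁻¹
                  (regionOp OrthFlow.rot e hn a m2 Ω₀c Ac)⁻¹ f')|
              ≤ c₁ * Real.exp (-(δ₁ * (bsuppDist n (fineDom n Ωc) f f'
                  + bdistV n (fineDom_mono hn hΩ) f + bdistV n (fineDom_mono hn hΩ) f'))) * bl2n f * bl2n f'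
          ∧ |f ⬝ᵥ dGv (fineDom_mono hn hΩ) (regionOp OrthFlow.rot e hn a m2 Ωc Ac)⁻¹
                (regionOp OrthFlow.rot e hn a m2 Ω₀c Ac)⁻¹ ((regionDeriv OrthFlow.rot e n Ωc Ac ν)ᵀ *ᵥ f')|
              ≤ c₁ * Real.exp (-(δ₁ * (bsuppDist n (fineDom n Ωc) f f'
                  + bdistV n (fineDom_mono hn hΩ) f + bdistV n (fineDom_mono hn hΩ) f'))) * bl2n f * bl2n f'
          ∧ |f ⬝ᵥ (regionDeriv OrthFlow.rot e n Ωc Ac μ *ᵥ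
                dGv (fineDom_mono hn hΩ) (regionOp OrthFlow.rot e hn a m2 Ωc Ac)⁻¹
                  (regionOp OrthFlow.rot e hn a m2 Ω₀c Ac)⁻¹ ((regionDeriv OrthFlow.rot e n Ωc Ac ν)ᵀ *ᵥ f'))|
              ≤ c₁ * Real.exp (-(δ₁ * (bsuppDist n (fineDom n Ωc) f f'
                  + bdistV n (fineDom_mono hn hΩ) f + bdistV n (fineDom_mono hn hΩ) f'))) * bl2n f * bl2n f' :=
  dcor23_region_exists (d := d) OrthFlow.rot zero_le_one rot_lipschitz ha hc hβ

/-! ## Numerical sanity: the constants at `d = 3`, `a = 1` (no bearing on the theorems) -/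

/-- `K₀(1/4) = 136`, `K₁(1/4) = 4624`. [folklore] -/
example : K0 (1 / 4 : ℝ) = 136 ∧ K1 (1 / 4 : ℝ) = 4624 := by
  unfold K0 K1; constructor <;> norm_num

end

end Literature.MathematicalPhysics.QuantumFieldTheory.Balaban1983to89.B4Cor23RegionDelta
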